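import Literature.AlgebraicGeometry.Milne1999.SpecialLefschetzGroupInvariantsImaginaryQuadratic
import Literature.Barriers.HodgeConjecture.CMHodgeRingNotGeneratedInCodimensionTwo
import Mathlib.LinearAlgebra.Lagrange
import Mathlib.LinearAlgebra.Eigenspace.Minpoly
import Mathlib.LinearAlgebra.BilinearForm.Orthogonal
import Mathlib.Algebra.BigOperators.Fin
import HarnessLib

/-!
# Milne 1999, Theorem 3.2 / Corollary 4.5 for real multiplication: the `S(A)`-invariants of a complex
# abelian variety whose `C(A) ⊗ ℂ` is the commutant of one diagonalisable Rosati-symmetric `φ^*` are the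
# Lefschetz classes (several symplectic blocks, `S(A)(ℂ) = ∏_σ Sp(H_σ)`)

Family `hodge`, layer `Literature/AlgebraicGeometry/Milne1999`, namespace
`Literature.AlgebraicGeometry.Milne1999` (D-0022). THEOREMS ONLY (no definition, no named fact; D-0026).
Written for the cell `pub-hodgecm2` (COR-CM), seat `lit-milne`, binder table `HOME/lit/milne.md` rows
M2/M4, as the sequel of `Milne1999/SpecialLefschetzGroupInvariantsSymplectic` (ONE symplectic block:
`C(A) ⊗ ℂ = End(H¹)`, `S(A)(ℂ) = Sp(H¹, Q_h)`) and `Milne1999/SpecialLefschetzGroupInvariantsImaginaryQuadratic`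
(`S(A)(ℂ) ≅ GL(W)`) on a third locus: SEVERAL symplectic blocks. The cited record
`Milne1999_specialLefschetzGroup_invariants_le` of `Milne1999/LefschetzGroup` (Cor. 4.5 with Thm. 4.4 and
Thm. 3.2: for EVERY complex abelian variety, the classes of `H²ᵖ(A(ℂ); ℂ)` fixed by
`specialLefschetzGroup (dim A) A.X` lie in `Dᵖ_hom(A)_ℂ`) rests, for a general `A`, on the first
fundamental theorem of invariant theory over the factors of `C(A)` (Prop. 3.6). This file PROVES its
conclusion for the abelian varieties `A` carrying an endomorphism `φ` such that

* `φ^*` is diagonalisable on `H¹(A(ℂ); ℂ)` (`⨆_μ ker(φ^* - μ) = H¹`),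
* `φ^*` is symmetric for the polarization pairing `Q_h` of a polarization class `h`
  (`Q_h(φ^*x, y) = Q_h(x, φ^*y)`: `φ† = φ` for the Rosati involution of `h`), and
* `C(A) ⊗ ℂ` is the commutant of `φ^*` alone (`centralizerAlgebra A = Subalgebra.centralizer ℂ {φ^*}`),

i.e. REAL MULTIPLICATION by `F = ℚ(φ)` with `C(A) ⊗ ℂ = End_{F ⊗ ℂ}(H¹) = ∏_σ End(H¹_σ)` — Milne's
"simple abelian variety of type I" (and also, e.g., products `B₁ × ⋯ × B_t` of pairwise non-isogenous
abelian varieties with `End(Bᵢ) = ℤ`, `φ = Σ i · e_i`). Then `H¹ = ⊕_σ H¹_σ` (eigenspaces of `φ^*`,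
pairwise `Q_h`-orthogonal) and `S(A)(ℂ) = ∏_σ Sp(H¹_σ, Q_h)`: Milne's case (a) of Prop. 3.6 with
`r = 1` in every block, glued by Lemma 3.1 / p. 656.

## Source, verbatim

J. S. Milne, *Lefschetz classes on abelian varieties*, Duke Math. J. 96 (1999) 639–675
[`paper:doi-10-1215-s0012-7094-99-09620-5`, held; PDF page = printed page − 638]:

* §1 p. 644 (p0006): "The group `S(A)`. […] `S(A)(R) = {γ ∈ C(A) ⊗_k R | γ†γ = 1}`. Thus, for any ample
  divisor `D` on `A`, `S(A)` is the largest algebraic subgroup of `Sp(e_D)` whose elements commute with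
  the endomorphisms of `A`."
* §2 p. 646 (p0008): "`F` = the subfield of `K` on which the Rosati involutions act trivially […] The field
  `F` is totally real […] `e_D(αx, y) = e_D(x, α†y)`, all `α ∈ E` […] Let `F ⊗_ℚ k = F₁ × ⋯ × F_t` be the
  decomposition of `F ⊗_ℚ k` into a product of fields, and let `1 = e₁ + ⋯ + e_t` be the corresponding
  decomposition of `1` into a sum of orthogonal idempotents. Then `V(A) = V₁ ⊕ ⋯ ⊕ V_t`, `Vᵢ = eᵢV`
  […] Any `k`-linear map `α : V → V` commuting with the action of `F` decomposes into
  `α = α₁ ⊕ ⋯ ⊕ α_t`"; p. 647 (p0009): "Because `φ ∘ (α × 1) = φ ∘ (1 × α)` for `α ∈ F`, `φ`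
  decomposes into `φ = φ₁ ⊕ ⋯ ⊕ φ_t`".
* §2 p. 648 (p0010), "Simple abelian variety of type I. In this case `E = F`. […]
  `(V(A), φ) = (V₁, φ₁) ⊕ ⋯ ⊕ (V_t, φ_t)` […] Here `φᵢ` is a nondegenerate skew-symmetric form on the
  `Fᵢ`-vector space `Vᵢ`. Therefore, `C(A) = C₁ × ⋯ × C_t`, `Cᵢ = End_{Fᵢ}(Vᵢ) ≈ M_{2g/f}(Fᵢ)` and the
  involution sends an element of `Cᵢ` to its adjoint with respect to `φᵢ`. Moreover,
  `S(A) = S₁ × ⋯ × S_t`, `Sᵢ = Res_{Fᵢ/k} Sp(φᵢ)`."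
* Thm. 3.2 (p. 653, p0015): "For any abelian variety `A` over `Ω` and integer `r ≥ 0`, the `k`-algebra
  `H*(A^r)^{S(A)}` is generated by divisor classes."; Prop. 3.3: "the `k`-vector space `H²(A^r)^{S(A)}` is
  generated by divisor classes."; Prop. 3.4: "`H*(A^r)^{S(A)} = k[H²(A^r)^{S(A)}]`."
* Prop. 3.6 (p. 655, p0017): "With the above notations, `(⋀^*(rH))^G = k[(⊗²rH)^G]` all `r ≥ 1`, in each of
  the following cases: (a) `G = Sp(φ)` with `φ` a nondegenerate skew-symmetric form on `V`; […]"; its proof: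
  "`(H₁ ⊕ ⋯ ⊕ H_r)^{⊗m}` is a direct sum of spaces of the form `H₁^{⊗i₁} ⊗ ⋯ ⊗ H_r^{⊗i_r}`,
  `i₁ + ⋯ + i_r = m` […] the `G`-invariant tensors are linear combinations of the forms `φ ⊗ ⋯ ⊗ φ`".
* p. 656 (p0018), "Completion of the proof of Proposition 3.4. […] Let `F` be the largest totally real
  subfield of the centre of `End⁰(A)`. Then (see Section 2) there are decompositions `H = ⊕_{σ:F→k} H_σ`,
  `S(A) = ∏_{σ:F→k} S_σ`, and so (see 3.1), `(⋀(rH))^{S(A)} = ⊗_σ (⋀ rH_σ)^{S_σ}`. Now the explicit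
  description of `S_σ` and its representation on `H_σ`, together with Proposition 3.6, show that each of the
  `k`-algebras `(⋀ rH_σ)^{S_σ}` is generated by tensors of degree `2`".
* Cor. 4.5 and p. 659 (p0021): "For any abelian variety `A` and any `r ≥ 0`,
  `H^{2*}(A^r)(*)^{L(A)} = D_hom(A^r)_k`. […] the kernel of `l(A)` […] equals `S(A)`."

## What is proved (`r = 1`, complex `A`, Betti cohomology, on the tree's carriers)

Data: a complex abelian variety `A`, `φ : A ⟶ A` with `φ^* = pullbackOne A φ` diagonalisable on
`H¹(A(ℂ); ℂ)`, `centralizerAlgebra A = Subalgebra.centralizer ℂ {φ^*}`, and a class `h ∈ H²(A(ℂ); ℂ)`,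
rational with a Kähler multiple `s · h` (`s > 0`), whose polarization pairing `Q_h`
(`Motives.polarizationPairingOne`) satisfies `Q_h(φ^*x, y) = Q_h(x, φ^*y)`.

* `exists_blockSymplecticBasis` (linear algebra) — for a non-degenerate alternating `B` and a diagonalisable
  `B`-self-adjoint `J`: a basis `(e^k_i, f^k_i)_{k < m, i < n_k}` of eigenvectors of `J` (`J = μ_k` on block
  `k`, `μ` injective), symplectic in each block and `B`-orthogonal across blocks ("`(V, φ) = ⊕ (Vᵢ, φᵢ)`").
* `exists_blockTorusElement`, `exists_blockPermElement` — the torus cocharacters and the Weyl-group block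
  permutations of `∏_k Sp(V_k)` preserve `B`; `mul_eq_mul_of_blockDiag`, `mul_eq_mul_of_blockPerm` — they
  commute with `J` (hence lie in `S(A)(ℂ) = unitaryCentralizerGroup A h`).
* **`mem_of_forall_exteriorPullback_eq_of_blockBasis`** — the weight / Weyl-group ENGINE for several blocks:
  for a subgroup `G ≤ GL(H¹)` containing these elements and a subspace `M ≤ Hᵈ(A(ℂ); ℂ)`, if every
  block-balanced `d`-set `s₀` of basis indices carries a non-zero `G`-invariant `y ∈ M` supported on the
  `d`-sets with the block counts of `s₀`, then every `G`-invariant class of `Hᵈ` lies in `M`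
  (`balanced_of_repr_ne_zero`: the torus confines supports to balanced sets;
  `exists_blockPerm_map_eq_of_balanced` + `repr_eq_zero_of_blockCount_eq`: the block permutations are
  transitive on balanced sets with given block counts and tie the coefficients along an orbit).
* `exteriorPullback_two_sum_smul` (polarization of `L ↦ ⋀²L`),
  `exteriorPullback_aeval_pullbackOne_mem_hodgeClassSpan_one`, **`exists_blockProjector`** — the block
  projectors `e_k = ℓ_k(φ^*)` (Lagrange interpolation; Milne's idempotents `eᵢ`) satisfy
  `⋀²e_k (B¹ ⊗ ℂ) ⊆ B¹ ⊗ ℂ`: `⋀²(Σ_j c_j (φ^j)^*) h` is a `ℂ`-combination of the rational `(1,1)`-classes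
  `(φ^j)^* h`, `(φ^i + φ^j)^* h`. So the BLOCK COMPONENTS `ω_k = ⋀²e_k h ∈ B¹(A) ⊗ ℂ` (the `φ_σ` of
  p. 647), and `h = Σ_k ω_k` (`h` is `S(A)(ℂ)`-invariant, so supported on the pairs `{e^k_i, f^k_i}`).
* `wordProd_*` (§6) — the products `ω_w = ω_{w₁} ∪ ⋯ ∪ ω_{w_q}` along words `w : [q] → [m]` (presented
  by their recursion `hY0`/`hYs`, no definition): they lie in `D^q ⊗ ℂ`, depend only on the letter counts
  (`wordProd_comp_perm`: associativity and graded commutativity of the cup product), are supported on the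
  `2q`-sets meeting block `k` in `2 · #w⁻¹(k)` indices, vanish when a letter `k` occurs more than `n_k`
  times, and `(Σ_k ω_k)^q = Σ_w ω_w` (`cupPowTwo_sum_eq_sum_wordProd`); since `h^{dim A} ≠ 0`
  (Voisin I Cor. 3.9) and the full words form one orbit, `ω_w ≠ 0` whenever `#w⁻¹(k) ≤ n_k` for all `k`
  (`wordProd_ne_zero_of_le`) — the non-vanishing of Milne's generators `φ ⊗ ⋯ ⊗ φ ∈ H₁^{⊗i₁} ⊗ ⋯ ⊗ H_r^{⊗i_r}`.
* **`mem_divisorClassesSpan_of_forall_exteriorPullback_eq_of_selfAdjoint`** — Prop. 3.6 (a) in every block,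
  glued (p. 656): every class of `H²ᵖ(A(ℂ); ℂ)` fixed by `⋀²ᵖu` for all `u ∈ S(A)(ℂ)` lies in
  `Dᵖ(A) ⊗ ℂ = divisorClassesSpan A.X (dim A) p` (indeed in the span of the `ω_w`, `|w| = p`).
* **`specialLefschetzGroup_invariants_le_of_selfAdjoint`** — the conclusion of the record
  `Milne1999_specialLefschetzGroup_invariants_le` for such `A` (`⋀•u ∈ specialLefschetzGroup` for
  `u ∈ S(A)(ℂ)`, `exteriorPullbackEquiv_mem_specialLefschetzGroup`, Thm. 4.4);
  `setOf_forall_apply_eq_self_eq_divisorClassesSpan_of_selfAdjoint` (Cor. 4.5 as an equality of sets);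
  `isDivisorGenerated_of_hodgeGroup_eq_specialLefschetzGroup_of_selfAdjoint` (Prop. 4.8 (c) ⇒ (a) on `A`,
  unconditional for such `A`).

## The proof (NOT Milne's road — weights and the Weyl group instead of the first fundamental theorem)

Milne deduces Prop. 3.6 (a) from the FFT for `Sp(φ)` on tensors (Fulton–Harris F.13), block by block, and
glues with Lemma 3.1; Mathlib has no invariant theory of the classical groups. Here, for `r = 1`: choose the
block-symplectic eigenbasis (§1) and the cup-monomial basis `b_s` (`s` a `d`-set of indices) of
`Hᵈ = ⋀ᵈH¹` (`Pohlmann1968.exists_monomialBasis`). (1) TORUS: `2` on `e^k_i`, `2⁻¹` on `f^k_i` ⇒ an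
invariant class is supported on sets balanced in every pair. (2) WEYL GROUP `∏_k S_{n_k}`: transitive on the
balanced sets with given block counts `(2p_k)_k`, acting on the coefficients by signs ⇒ the invariants of
`H²ᵖ` inject into `ℂ^{profiles}`. (3) GENERATORS: for each profile `(p_k)`, `p_k ≤ n_k`, the divisor-class
product `∏_k ω_k^{p_k} ∈ Dᵖ ⊗ ℂ` is invariant, supported on that profile, and NON-ZERO (expansion of
`h^{dim A} ≠ 0`); subtracting multiples kills all coefficients (engine, §4). Degree `0` and `dim A = 0` are
treated apart (`H⁰ = ℂ · 1`, `H^{2p} = 0`).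

NOT here: blocks of type (b) `O(φ)` / (c) `GL(W)` with `r ≥ 2`, type II/III algebras, several `φ`'s (a
general commutative `F ⊗ ℂ` is generated by one element, so one `φ` is no restriction for type I with
`C(A) ⊗ ℂ = End_{F⊗ℂ}(H¹)`), powers `A^r` — the record stays cited for those `A`.

## References

* [Milne1999LefschetzClasses] J. S. Milne, Lefschetz classes on abelian varieties, Duke Math. J. 96
  (1999) 639–675: §1 p. 644, §2 pp. 646–648 (type I), Lemma 3.1, Thm. 3.2, Props. 3.3–3.4, 3.6 (a)
  (pp. 652–656), p. 656 ("Completion of the proof of Prop. 3.4"), Lemma 3.8, Thm. 4.4, Cor. 4.5 (p. 659),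
  Prop. 4.8 (p. 660).
* [FultonHarris1991] W. Fulton, J. Harris, Representation Theory. A First Course, GTM 129 (1991): §16.1
  (weights `±Lᵢ` of `Sp_{2n}`, Weyl group), Thm. 17.5, App. F.13.
* [McDuffSalamon2017] D. McDuff, D. Salamon, Introduction to Symplectic Topology, 3rd ed. (2017),
  Thm. 2.1.3 (symplectic bases).
* [Hazama1983] F. Hazama, Algebraic cycles on abelian varieties with many real endomorphisms, Tôhoku
  Math. J. 35 (1983) 303–308, §3 (`H¹(A, ℂ) = V₁ ⊕ ⋯ ⊕ V_k`) — context (real multiplication).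
* [vanGeemen1994HodgeAV] B. van Geemen, An introduction to the Hodge conjecture for abelian varieties,
  LNM 1594 (1994), §2.4 (`Dᵖ`), 4.8 (the action of `End(X)_ℚ` on `⋀•H¹`).
* [VoisinHodgeI2002] C. Voisin, Hodge Theory and Complex Algebraic Geometry I (2002), §3.1.3 Cor. 3.9,
  §7.1.2.
* [HatcherAT2002] A. Hatcher, Algebraic Topology (2002), §3.2 (cup product; Prop. 3.10, Thm. 3.11).
* [Hazama2003GHCCM] F. Hazama, Publ. RIMS 39 (2003), (4.C)/(4.1) p. 631 (exterior-algebra bookkeeping of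
  supports, as used by `Barriers/HodgeConjecture/CMHodgeRingNotGeneratedInCodimensionTwo`).
* [LangeBirkenhake1992] H. Lange, Ch. Birkenhake, Complex Abelian Varieties (1992), §1.2, Lemma 1.1.17.
-/

noncomputable section

open CategoryTheory Polynomial
open Literature.AlgebraicTopology.SingularHomology
open Literature.AlgebraicGeometry.HodgeTheory
open Literature.AlgebraicGeometry.Motives
open Literature.AlgebraicGeometry.VanGeemen1994 (pullbackOne hodgeClassSpan)
open Literature.AlgebraicGeometry.Pohlmann1968 (exists_monomialBasis)
open Literature.Barriers.HodgeConjecture (divisorClassesSpan divisorMonomials mem_divisorMonomials_zero)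
open Literature.Geometry.Kaehler (lefschetzPow)

namespace Literature.AlgebraicGeometry.Milne1999

/-! ### §1 Linear algebra: a block-symplectic basis adapted to a diagonalisable self-adjoint `J` -/

section BlockBasis

variable {V : Type*} [AddCommGroup V] [Module ℂ V]

/-- Eigenvectors of a `B`-self-adjoint operator for distinct eigenvalues are `B`-orthogonal ("Because
`φ ∘ (α × 1) = φ ∘ (1 × α)` for `α ∈ F`, `φ` decomposes into `φ = φ₁ ⊕ ⋯ ⊕ φ_t`").
[cite: Milne1999LefschetzClasses, §2 p. 647] -/
theorem apply_eq_zero_of_mem_eigenspace_of_ne (B : LinearMap.BilinForm ℂ V) (J : Module.End ℂ V)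
    (hJB : ∀ x y, B (J x) y = B x (J y)) {μ ν : ℂ} (hμν : μ ≠ ν) {x y : V}
    (hx : x ∈ J.eigenspace μ) (hy : y ∈ J.eigenspace ν) : B x y = 0 := by
  rw [Module.End.mem_eigenspace_iff] at hx hy
  have e := hJB x y
  rw [hx, hy, map_smul, LinearMap.smul_apply, map_smul, smul_eq_mul, smul_eq_mul] at e
  have e' : (μ - ν) * B x y = 0 := by rw [sub_mul, e, sub_self]
  rcases mul_eq_zero.1 e' with h | h
  · exact absurd (sub_eq_zero.1 h) hμν
  · exact h

variable [FiniteDimensional ℂ V]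

/-- **A block-symplectic basis.** Let `B` be a non-degenerate alternating form on a finite-dimensional
complex vector space `V` and `J` a diagonalisable (`⨆ μ, V_μ = V`) `B`-self-adjoint operator
(`B(Jx, y) = B(x, Jy)`). Then `V` has a basis `(e^k_i, f^k_i)` (`k < m` the blocks, `i < n_k`) of
eigenvectors of `J` — `J = μ_k` on block `k`, the `μ_k` pairwise distinct — which is symplectic block by
block (`B(e^k_i, f^k_j) = δ_{ij}`, `B(e, e) = B(f, f) = 0`) with `B = 0` between distinct blocks: the
eigenspaces are pairwise `B`-orthogonal, so `B` is non-degenerate and alternating on each, and each has a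
symplectic basis (McDuff–Salamon Thm. 2.1.3). This is the decomposition
"`(V(A), φ) = (V₁, φ₁) ⊕ ⋯ ⊕ (V_t, φ_t)`" of Milne §2 for a self-adjoint generator of `F ⊗ ℂ`.
[cite: Milne1999LefschetzClasses, §2 pp. 646–648] [cite: McDuffSalamon2017, Thm. 2.1.3] -/
theorem exists_blockSymplecticBasis (B : LinearMap.BilinForm ℂ V) (hBalt : B.IsAlt) (hBnd : B.Nondegenerate)
    (J : Module.End ℂ V) (hJ : ⨆ μ, J.eigenspace μ = ⊤) (hJB : ∀ x y, B (J x) y = B x (J y)) :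
    ∃ (m : ℕ) (n : Fin m → ℕ) (μ : Fin m → ℂ) (b : Module.Basis (Σ k : Fin m, Fin (n k) ⊕ Fin (n k)) ℂ V),
      Function.Injective μ ∧
      (∀ a, J (b a) = μ a.1 • b a) ∧
      (∀ a c, a.1 ≠ c.1 → B (b a) (b c) = 0) ∧
      (∀ k (i j : Fin (n k)), B (b ⟨k, Sum.inl i⟩) (b ⟨k, Sum.inl j⟩) = 0) ∧
      (∀ k (i j : Fin (n k)), B (b ⟨k, Sum.inr i⟩) (b ⟨k, Sum.inr j⟩) = 0) ∧
      (∀ k (i j : Fin (n k)), B (b ⟨k, Sum.inl i⟩) (b ⟨k, Sum.inr j⟩) = if i = j then 1 else 0) := by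
  classical
  -- the eigenvalues, enumerated
  set m : ℕ := Fintype.card J.Eigenvalues with hm_def
  set e : J.Eigenvalues ≃ Fin m := Fintype.equivFin J.Eigenvalues with he_def
  set μ : Fin m → ℂ := fun k => ((e.symm k : J.Eigenvalues) : ℂ) with hμ_def
  have hμinj : Function.Injective μ := fun k k' h =>
    e.symm.injective (Subtype.ext h)
  set E : Fin m → Submodule ℂ V := fun k => J.eigenspace (μ k) with hE_def
  -- internal direct sum
  have hind : iSupIndep E := (Module.End.eigenspaces_iSupIndep J).comp hμinj
  have htop : iSup E = ⊤ := by
    refine eq_top_iff.2 ?_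
    rw [← hJ]
    refine iSup_le fun ν => ?_
    by_cases hν : J.HasEigenvalue ν
    · have : J.eigenspace ν = E (e ⟨ν, hν⟩) := by
        simp only [hE_def, hμ_def, Equiv.symm_apply_apply]
        rfl
      rw [this]
      exact le_iSup E _
    · rw [Module.End.hasEigenvalue_iff, not_ne_iff] at hν
      rw [hν]
      exact bot_le
  have hint : DirectSum.IsInternal E := DirectSum.isInternal_submodule_of_iSupIndep_of_iSup_eq_top hind htop
  -- orthogonality of distinct blocks
  have horth : ∀ {k k' : Fin m}, k ≠ k' → ∀ {x y : V}, x ∈ E k → y ∈ E k' → B x y = 0 :=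
    fun {k k'} hkk' {x y} hx hy => apply_eq_zero_of_mem_eigenspace_of_ne B J hJB (hμinj.ne hkk') hx hy
  -- each block is non-degenerate and alternating
  have hBrefl : B.IsRefl := hBalt.isRefl
  have hsep : ∀ x : V, (∀ y, B x y = 0) → x = 0 := fun x hx =>
    (hBalt.isRefl.nondegenerate_iff_separatingLeft.1 hBnd) x hx
  have hdisj : ∀ k, Disjoint (E k) (B.orthogonal (E k)) := by
    intro k
    rw [Submodule.disjoint_def]
    intro x hx hx'
    rw [LinearMap.BilinForm.mem_orthogonal_iff] at hx'
    -- `B y x = 0` for every `y`: decompose `y` along `⨆ E = ⊤`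
    have hall : ∀ y, B y x = 0 := by
      intro y
      have hy : y ∈ iSup E := by rw [htop]; exact Submodule.mem_top
      induction hy using Submodule.iSup_induction' with
      | mem k' z hz =>
        by_cases hk : k' = k
        · subst hk; exact hx' z hz
        · exact horth hk hz hx
      | zero => rw [map_zero, LinearMap.zero_apply]
      | add z w _ _ hz hw => rw [map_add, LinearMap.add_apply, hz, hw, add_zero]
    exact hsep x fun y => by rw [← hBalt.neg_eq, hall, neg_zero]
  have hres : ∀ k, (B.restrict (E k)).IsAlt ∧ (B.restrict (E k)).Nondegenerate := fun k =>
    ⟨fun x => hBalt (x : V), B.nondegenerate_restrict_of_disjoint_orthogonal hBrefl (hdisj k)⟩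
  choose n bk h11 h22 h12 using fun k =>
    Literature.Geometry.Symplectic.exists_symplecticBasis (B.restrict (E k)) (hres k).1 (hres k).2
  refine ⟨m, n, μ, hint.collectedBasis bk, hμinj, fun a => ?_, fun a c hac => ?_, fun k i j => ?_,
    fun k i j => ?_, fun k i j => ?_⟩
  · have hmem : hint.collectedBasis bk a ∈ E a.1 := hint.collectedBasis_mem bk a
    exact Module.End.mem_eigenspace_iff.1 hmem
  · exact horth hac (hint.collectedBasis_mem bk a) (hint.collectedBasis_mem bk c)
  · have e1 := h11 k i j
    rw [LinearMap.BilinForm.restrict_apply] at e1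
    rw [hint.collectedBasis_coe]
    exact e1
  · have e1 := h22 k i j
    rw [LinearMap.BilinForm.restrict_apply] at e1
    rw [hint.collectedBasis_coe]
    exact e1
  · have e1 := h12 k i j
    rw [LinearMap.BilinForm.restrict_apply] at e1
    rw [hint.collectedBasis_coe]
    exact e1

end BlockBasis

/-! ### §2 Elements of `∏ₖ Sp(V_k)`: the block torus and the block permutations -/


section BlockIndex

variable {m : ℕ} {n : Fin m → ℕ}

/-- The symplectic partner `e^k_i ↔ f^k_i` of a block-basis index is `a ↦ ⟨a.1, a.2.swap⟩`; it is an
involution. [folklore] -/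
private theorem sigma_swap_swap (a : Σ k : Fin m, Fin (n k) ⊕ Fin (n k)) :
    (⟨a.1, (⟨a.1, a.2.swap⟩ : Σ k : Fin m, Fin (n k) ⊕ Fin (n k)).2.swap⟩ : Σ k : Fin m, Fin (n k) ⊕ Fin (n k)) = a := by
  rcases a with ⟨k, i | i⟩ <;> rfl

/-- The partner of `e^k_i` is `f^k_i`. [folklore] -/
private theorem sigma_swap_inl (k : Fin m) (i : Fin (n k)) :
    (⟨k, (Sum.inl i : Fin (n k) ⊕ Fin (n k)).swap⟩ : Σ k : Fin m, Fin (n k) ⊕ Fin (n k)) = ⟨k, Sum.inr i⟩ := rfl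

/-- The partner of `f^k_i` is `e^k_i`. [folklore] -/
private theorem sigma_swap_inr (k : Fin m) (i : Fin (n k)) :
    (⟨k, (Sum.inr i : Fin (n k) ⊕ Fin (n k)).swap⟩ : Σ k : Fin m, Fin (n k) ⊕ Fin (n k)) = ⟨k, Sum.inl i⟩ := rfl

/-- The partner map is injective. [folklore] -/
private theorem eq_of_sigma_swap_eq {a c : Σ k : Fin m, Fin (n k) ⊕ Fin (n k)}
    (h : (⟨a.1, a.2.swap⟩ : Σ k : Fin m, Fin (n k) ⊕ Fin (n k)) = ⟨c.1, c.2.swap⟩) : a = c := by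
  obtain ⟨k, x⟩ := a
  obtain ⟨k', y⟩ := c
  simp only [Sigma.mk.inj_iff] at h
  obtain ⟨hk, hxy⟩ := h
  subst hk
  simp only [heq_eq_eq] at hxy
  have e := congrArg Sum.swap hxy
  rw [Sum.swap_swap, Sum.swap_swap] at e
  subst e
  rfl

/-- The block permutation `e^k_i ↦ e^k_{σ_k i}`, `f^k_i ↦ f^k_{σ_k i}` on the `e`'s. [folklore] -/
private theorem sigmaCongrRight_sumCongr_apply_inl (σ : ∀ k : Fin m, Equiv.Perm (Fin (n k))) (k : Fin m) (i : Fin (n k)) :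
    (Equiv.sigmaCongrRight fun k => (σ k).sumCongr (σ k)) ⟨k, Sum.inl i⟩ = ⟨k, Sum.inl (σ k i)⟩ := rfl

/-- The block permutation on the `f`'s. [folklore] -/
private theorem sigmaCongrRight_sumCongr_apply_inr (σ : ∀ k : Fin m, Equiv.Perm (Fin (n k))) (k : Fin m) (i : Fin (n k)) :
    (Equiv.sigmaCongrRight fun k => (σ k).sumCongr (σ k)) ⟨k, Sum.inr i⟩ = ⟨k, Sum.inr (σ k i)⟩ := rfl

/-- The inverse block permutation on the `e`'s. [folklore] -/
private theorem sigmaCongrRight_sumCongr_symm_apply_inl (σ : ∀ k : Fin m, Equiv.Perm (Fin (n k))) (k : Fin m)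
    (i : Fin (n k)) :
    (Equiv.sigmaCongrRight fun k => (σ k).sumCongr (σ k)).symm ⟨k, Sum.inl i⟩ = ⟨k, Sum.inl ((σ k).symm i)⟩ := rfl

/-- The inverse block permutation on the `f`'s. [folklore] -/
private theorem sigmaCongrRight_sumCongr_symm_apply_inr (σ : ∀ k : Fin m, Equiv.Perm (Fin (n k))) (k : Fin m)
    (i : Fin (n k)) :
    (Equiv.sigmaCongrRight fun k => (σ k).sumCongr (σ k)).symm ⟨k, Sum.inr i⟩ = ⟨k, Sum.inr ((σ k).symm i)⟩ := rfl

/-- A block permutation preserves the block. [folklore] -/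
private theorem sigmaCongrRight_sumCongr_fst (σ : ∀ k : Fin m, Equiv.Perm (Fin (n k)))
    (a : Σ k : Fin m, Fin (n k) ⊕ Fin (n k)) :
    ((Equiv.sigmaCongrRight fun k => (σ k).sumCongr (σ k)) a).1 = a.1 := by
  rcases a with ⟨k, i | i⟩ <;> rfl

/-- A block permutation commutes with the partner map. [folklore] -/
private theorem sigmaCongrRight_sumCongr_swap (σ : ∀ k : Fin m, Equiv.Perm (Fin (n k)))
    (a : Σ k : Fin m, Fin (n k) ⊕ Fin (n k)) :
    (Equiv.sigmaCongrRight fun k => (σ k).sumCongr (σ k)) ⟨a.1, a.2.swap⟩ =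
      ⟨((Equiv.sigmaCongrRight fun k => (σ k).sumCongr (σ k)) a).1,
        ((Equiv.sigmaCongrRight fun k => (σ k).sumCongr (σ k)) a).2.swap⟩ := by
  rcases a with ⟨k, i | i⟩ <;> rfl

/-- A block permutation preserves the type `e`/`f` of an index. [folklore] -/
private theorem sum_elim_sigmaCongrRight_sumCongr (σ : ∀ k : Fin m, Equiv.Perm (Fin (n k)))
    (a : Σ k : Fin m, Fin (n k) ⊕ Fin (n k)) :
    Sum.elim (fun _ => (1 : ℂ)) (fun _ => -1) ((Equiv.sigmaCongrRight fun k => (σ k).sumCongr (σ k)) a).2 =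
      Sum.elim (fun _ => (1 : ℂ)) (fun _ => -1) a.2 := by
  rcases a with ⟨k, i | i⟩ <;> rfl

end BlockIndex

section BlockGroup

variable {V : Type*} [AddCommGroup V] [Module ℂ V] {m : ℕ} {n : Fin m → ℕ} (B : LinearMap.BilinForm ℂ V)
  (b : Module.Basis (Σ k : Fin m, Fin (n k) ⊕ Fin (n k)) ℂ V)

/-- An automorphism preserving `B` on pairs of basis vectors preserves `B`. [folklore] -/
private theorem forall_apply_eq_of_basis' (u : V ≃ₗ[ℂ] V)
    (hu : ∀ a c, B (u (b a)) (u (b c)) = B (b a) (b c)) : ∀ x y, B (u x) (u y) = B x y := by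
  have hB : B.comp (u : V →ₗ[ℂ] V) (u : V →ₗ[ℂ] V) = B :=
    LinearMap.BilinForm.ext_basis b fun a c => by rw [LinearMap.BilinForm.comp_apply]; exact hu a c
  intro x y
  have e := congrArg (fun F : LinearMap.BilinForm ℂ V => F x y) hB
  simpa only [LinearMap.BilinForm.comp_apply, LinearEquiv.coe_coe] using e

variable (h11 : ∀ k (i j : Fin (n k)), B (b ⟨k, Sum.inl i⟩) (b ⟨k, Sum.inl j⟩) = 0)
  (h22 : ∀ k (i j : Fin (n k)), B (b ⟨k, Sum.inr i⟩) (b ⟨k, Sum.inr j⟩) = 0)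
  (h12 : ∀ k (i j : Fin (n k)), B (b ⟨k, Sum.inl i⟩) (b ⟨k, Sum.inr j⟩) = if i = j then 1 else 0)
  (h21 : ∀ k (i j : Fin (n k)), B (b ⟨k, Sum.inr i⟩) (b ⟨k, Sum.inl j⟩) = if i = j then -1 else 0)
  (hcross : ∀ a c, a.1 ≠ c.1 → B (b a) (b c) = 0)
include h11 h22 h12 h21 hcross

/-- **The Gram matrix of a block-symplectic basis**: `B(v_a, v_c) = ± 1` if `c` is the symplectic partner
of `a`, and `0` otherwise. [cite: McDuffSalamon2017, Thm. 2.1.3] -/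
theorem apply_basis_eq (a c : Σ k : Fin m, Fin (n k) ⊕ Fin (n k)) :
    B (b a) (b c) = if c = ⟨a.1, a.2.swap⟩ then Sum.elim (fun _ => (1 : ℂ)) (fun _ => -1) a.2 else 0 := by
  by_cases hk : a.1 = c.1
  · obtain ⟨k, x⟩ := a
    obtain ⟨k', y⟩ := c
    simp only at hk
    subst hk
    rcases x with i | i <;> rcases y with j | j
    · rw [h11, if_neg]
      simp
    · rw [h12]
      by_cases hij : i = j
      · subst hij; simp
      · rw [if_neg hij, if_neg]
        simpa [Sigma.mk.inj_iff] using Ne.symm hij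
    · rw [h21]
      by_cases hij : i = j
      · subst hij; simp
      · rw [if_neg hij, if_neg]
        simpa [Sigma.mk.inj_iff] using Ne.symm hij
    · rw [h22, if_neg]
      simp
  · rw [hcross _ _ hk, if_neg]
    intro h
    apply hk
    rw [h]

/-- **A cocharacter of the diagonal torus of `∏ₖ Sp(V_k)`**: for a block-symplectic basis and an index
`(k₀, i₀)`, the automorphism `u = 2` on `e^{k₀}_{i₀}`, `2⁻¹` on `f^{k₀}_{i₀}`, `1` on the other basis
vectors preserves `B`; its weight `∏_{a ∈ s} d_a` on a set `s` of basis vectors is `1` only if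
`e^{k₀}_{i₀} ∈ s ⟺ f^{k₀}_{i₀} ∈ s`. [cite: FultonHarris1991, §16.1] [cite: Milne1999LefschetzClasses, §3 Lemma 3.8 and Prop. 3.6 (a)] -/
theorem exists_blockTorusElement (k₀ : Fin m) (i₀ : Fin (n k₀)) :
    ∃ u : V ≃ₗ[ℂ] V, (∀ x y, B (u x) (u y) = B x y) ∧ ∃ d : (Σ k : Fin m, Fin (n k) ⊕ Fin (n k)) → ℂ,
      (∀ a, u (b a) = d a • b a) ∧
      ∀ s : Finset (Σ k : Fin m, Fin (n k) ⊕ Fin (n k)), ∏ a ∈ s, d a = 1 →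
        ((⟨k₀, Sum.inl i₀⟩ : Σ k : Fin m, Fin (n k) ⊕ Fin (n k)) ∈ s ↔ ⟨k₀, Sum.inr i₀⟩ ∈ s) := by
  classical
  have h12' : (⟨k₀, Sum.inl i₀⟩ : Σ k : Fin m, Fin (n k) ⊕ Fin (n k)) ≠ ⟨k₀, Sum.inr i₀⟩ := by
    simp
  let d : (Σ k : Fin m, Fin (n k) ⊕ Fin (n k)) → ℂ := fun a =>
    (if a = ⟨k₀, Sum.inl i₀⟩ then (2 : ℂ) else 1) * (if a = ⟨k₀, Sum.inr i₀⟩ then (2 : ℂ)⁻¹ else 1)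
  have hd_def : ∀ a, d a =
      (if a = ⟨k₀, Sum.inl i₀⟩ then (2 : ℂ) else 1) * (if a = ⟨k₀, Sum.inr i₀⟩ then (2 : ℂ)⁻¹ else 1) :=
    fun a => rfl
  have hd0 : ∀ a, d a ≠ 0 := fun a => by
    rw [hd_def]
    split_ifs <;> norm_num
  -- `d a * d (mate a) = 1`
  have hpair : ∀ a : Σ k : Fin m, Fin (n k) ⊕ Fin (n k),
      d a * d ⟨a.1, a.2.swap⟩ = 1 := by
    intro a
    by_cases h1 : a = ⟨k₀, Sum.inl i₀⟩
    · subst h1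
      rw [hd_def, hd_def, sigma_swap_inl, if_pos rfl, if_neg h12', if_neg (Ne.symm h12'), if_pos rfl]
      norm_num
    · by_cases h2 : a = ⟨k₀, Sum.inr i₀⟩
      · subst h2
        rw [hd_def, hd_def, sigma_swap_inr, if_neg (Ne.symm h12'), if_pos rfl, if_pos rfl, if_neg h12']
        norm_num
      · have h3 : (⟨a.1, a.2.swap⟩ : Σ k : Fin m, Fin (n k) ⊕ Fin (n k)) ≠ ⟨k₀, Sum.inl i₀⟩ := fun h =>
          h2 (eq_of_sigma_swap_eq (c := ⟨k₀, Sum.inr i₀⟩) h)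
        have h4 : (⟨a.1, a.2.swap⟩ : Σ k : Fin m, Fin (n k) ⊕ Fin (n k)) ≠ ⟨k₀, Sum.inr i₀⟩ := fun h =>
          h1 (eq_of_sigma_swap_eq (c := ⟨k₀, Sum.inl i₀⟩) h)
        rw [hd_def, hd_def, if_neg h1, if_neg h2, if_neg h3, if_neg h4]
        norm_num
  let w : (Σ k : Fin m, Fin (n k) ⊕ Fin (n k)) → ℂˣ := fun a => Units.mk0 (d a) (hd0 a)
  let u : V ≃ₗ[ℂ] V := b.equiv (b.unitsSMul w) (Equiv.refl _)
  have hd : ∀ a, u (b a) = d a • b a := fun a => by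
    simp only [u, w, Module.Basis.equiv_apply, Equiv.refl_apply, Module.Basis.unitsSMul_apply, Units.smul_def,
      Units.val_mk0]
  refine ⟨u, forall_apply_eq_of_basis' B b u (fun a c => ?_), d, hd, fun s hs => ?_⟩
  · rw [hd, hd, LinearMap.BilinForm.smul_left, LinearMap.BilinForm.smul_right,
      apply_basis_eq B b h11 h22 h12 h21 hcross]
    by_cases hc : c = ⟨a.1, a.2.swap⟩
    · rw [if_pos hc, hc, ← mul_assoc, hpair, one_mul]
    · rw [if_neg hc, mul_zero, mul_zero]
  · have hprod : ∏ a ∈ s, d a = (if (⟨k₀, Sum.inl i₀⟩ : Σ k : Fin m, Fin (n k) ⊕ Fin (n k)) ∈ s then (2 : ℂ) else 1) *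
        (if (⟨k₀, Sum.inr i₀⟩ : Σ k : Fin m, Fin (n k) ⊕ Fin (n k)) ∈ s then (2 : ℂ)⁻¹ else 1) := by
      simp only [hd_def]
      rw [Finset.prod_mul_distrib, Finset.prod_ite_eq', Finset.prod_ite_eq']
    rw [hprod] at hs
    by_cases h1 : (⟨k₀, Sum.inl i₀⟩ : Σ k : Fin m, Fin (n k) ⊕ Fin (n k)) ∈ s <;>
      by_cases h2 : (⟨k₀, Sum.inr i₀⟩ : Σ k : Fin m, Fin (n k) ⊕ Fin (n k)) ∈ s
    · exact ⟨fun _ => h2, fun _ => h1⟩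
    · rw [if_pos h1, if_neg h2] at hs; norm_num at hs
    · rw [if_neg h1, if_pos h2] at hs; norm_num at hs
    · exact ⟨fun h => absurd h h1, fun h => absurd h h2⟩

/-- **The Weyl-group block permutations**: for a block-symplectic basis and `σ = (σ_k)_k`, the automorphism
`e^k_i ↦ e^k_{σ_k i}`, `f^k_i ↦ f^k_{σ_k i}` preserves `B`. [cite: FultonHarris1991, §16.1]
[cite: Milne1999LefschetzClasses, §3 Prop. 3.6 (a)] -/
theorem exists_blockPermElement (σ : ∀ k : Fin m, Equiv.Perm (Fin (n k))) :
    ∃ u : V ≃ₗ[ℂ] V, (∀ x y, B (u x) (u y) = B x y) ∧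
      ∀ a, u (b a) = b ((Equiv.sigmaCongrRight fun k => (σ k).sumCongr (σ k)) a) := by
  refine ⟨b.equiv b (Equiv.sigmaCongrRight fun k => (σ k).sumCongr (σ k)),
    forall_apply_eq_of_basis' B b _ (fun a c => ?_), fun a => by rw [Module.Basis.equiv_apply]⟩
  rw [Module.Basis.equiv_apply, Module.Basis.equiv_apply, apply_basis_eq B b h11 h22 h12 h21 hcross,
    apply_basis_eq B b h11 h22 h12 h21 hcross, sum_elim_sigmaCongrRight_sumCongr]
  by_cases hc : c = ⟨a.1, a.2.swap⟩
  · rw [if_pos hc, if_pos (by rw [hc, sigmaCongrRight_sumCongr_swap])]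
  · rw [if_neg hc, if_neg (fun h => hc ((Equiv.sigmaCongrRight fun k => (σ k).sumCongr (σ k)).injective
      (by rw [h, sigmaCongrRight_sumCongr_swap])))]

end BlockGroup

/-! ### §2b Diagonal and block-permutation automorphisms commute with a block-scalar operator -/

section Commute

variable {V : Type*} [AddCommGroup V] [Module ℂ V] {m : ℕ} {n : Fin m → ℕ}
  (b : Module.Basis (Σ k : Fin m, Fin (n k) ⊕ Fin (n k)) ℂ V) (J : Module.End ℂ V) {μ : Fin m → ℂ}
  (hJ : ∀ a, J (b a) = μ a.1 • b a)
include hJ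

/-- A diagonal automorphism of the block basis commutes with the block-scalar `J`. [cite: Milne1999LefschetzClasses, §2 p. 646 (`α = α₁ ⊕ ⋯ ⊕ α_t`)] -/
theorem mul_eq_mul_of_blockDiag (u : V ≃ₗ[ℂ] V) {d : (Σ k : Fin m, Fin (n k) ⊕ Fin (n k)) → ℂ}
    (hd : ∀ a, u (b a) = d a • b a) : J * (u : Module.End ℂ V) = (u : Module.End ℂ V) * J := by
  refine b.ext fun a => ?_
  simp only [Module.End.mul_apply, LinearEquiv.coe_coe, hd, map_smul, hJ]
  rw [smul_comm]

/-- A block permutation of the block basis commutes with the block-scalar `J` (it preserves every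
eigenspace). [cite: Milne1999LefschetzClasses, §2 p. 646 (`α = α₁ ⊕ ⋯ ⊕ α_t`)] -/
theorem mul_eq_mul_of_blockPerm (u : V ≃ₗ[ℂ] V) (σ : ∀ k : Fin m, Equiv.Perm (Fin (n k)))
    (hu : ∀ a, u (b a) = b ((Equiv.sigmaCongrRight fun k => (σ k).sumCongr (σ k)) a)) :
    J * (u : Module.End ℂ V) = (u : Module.End ℂ V) * J := by
  refine b.ext fun a => ?_
  simp only [Module.End.mul_apply, LinearEquiv.coe_coe, hu, hJ, map_smul, sigmaCongrRight_sumCongr_fst]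

end Commute

/-! ### §3 Block-balanced sets of basis indices and the transitivity of the block permutations -/

section Balanced

variable {m : ℕ} {n : Fin m → ℕ} {N : ℕ} (E : (Σ k : Fin m, Fin (n k) ⊕ Fin (n k)) ≃ Fin N)

/-- Two finite subsets of the same size of a finite type are exchanged by a permutation. [folklore] -/
private theorem exists_perm_mem_iff_of_card_eq' {α : Type*} [Fintype α] [DecidableEq α] {S T : Finset α}
    (h : S.card = T.card) : ∃ σ : Equiv.Perm α, ∀ a, σ a ∈ T ↔ a ∈ S := by
  have h1 : Fintype.card {a // a ∈ S} = Fintype.card {a // a ∈ T} := by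
    rw [Fintype.card_coe, Fintype.card_coe, h]
  have h2 : Fintype.card {a // a ∉ S} = Fintype.card {a // a ∉ T} := by
    rw [Fintype.card_subtype_compl, Fintype.card_subtype_compl, Fintype.card_coe, Fintype.card_coe, h]
  refine ⟨(Equiv.sumCompl (· ∈ S)).symm.trans (((Fintype.equivOfCardEq h1).sumCongr
    (Fintype.equivOfCardEq h2)).trans (Equiv.sumCompl (· ∈ T))), fun a => ?_⟩
  by_cases ha : a ∈ S
  · rw [Equiv.trans_apply, Equiv.trans_apply, Equiv.sumCompl_symm_apply_of_pos ha, Equiv.sumCongr_apply,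
      Sum.map_inl, Equiv.sumCompl_apply_inl]
    exact ⟨fun _ => ha, fun _ => (Fintype.equivOfCardEq h1 ⟨a, ha⟩).2⟩
  · rw [Equiv.trans_apply, Equiv.trans_apply, Equiv.sumCompl_symm_apply_of_neg ha, Equiv.sumCongr_apply,
      Sum.map_inr, Equiv.sumCompl_apply_inr]
    exact ⟨fun h => absurd h (Fintype.equivOfCardEq h2 ⟨a, ha⟩).2, fun h => absurd h ha⟩

/-- **Twice the number of `e`'s of block `k` in a balanced set is its block count** (a set balanced in
every symplectic pair `{e^k_i, f^k_i}` meets block `k` in the pairs it contains: the bookkeeping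
"`[Σ] = 0` if and only if `nᵢ = n_{m+i}`" of Lemma 3.8). [cite: Milne1999LefschetzClasses, §3 Lemma 3.8] -/
theorem two_mul_card_filter_eq_blockCount (k : Fin m) (S : Finset (Fin N))
    (hS : ∀ (k : Fin m) (i : Fin (n k)), E ⟨k, Sum.inl i⟩ ∈ S ↔ E ⟨k, Sum.inr i⟩ ∈ S) :
    2 * (Finset.univ.filter fun i : Fin (n k) => E ⟨k, Sum.inl i⟩ ∈ S).card =
      (S.filter fun j => (E.symm j).1 = k).card := by
  classical
  -- the block-`k` part of `S`, pulled back to `Fin (n k) ⊕ Fin (n k)`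
  set T : Finset (Fin (n k) ⊕ Fin (n k)) := Finset.univ.filter fun x => E ⟨k, x⟩ ∈ S with hT_def
  have hmemT : ∀ x, x ∈ T ↔ E ⟨k, x⟩ ∈ S := fun x => by
    rw [hT_def, Finset.mem_filter, and_iff_right (Finset.mem_univ _)]
  have hL : T.toLeft = Finset.univ.filter fun i : Fin (n k) => E ⟨k, Sum.inl i⟩ ∈ S := by
    ext i
    rw [Finset.mem_toLeft, hmemT, Finset.mem_filter, and_iff_right (Finset.mem_univ _)]
  have hR : T.toRight = Finset.univ.filter fun i : Fin (n k) => E ⟨k, Sum.inl i⟩ ∈ S := by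
    ext i
    rw [Finset.mem_toRight, hmemT, Finset.mem_filter, and_iff_right (Finset.mem_univ _)]
    exact (hS k i).symm
  -- `T` embeds onto the block-`k` part of `S`
  let ι₀ : (Fin (n k) ⊕ Fin (n k)) ↪ Fin N := ⟨fun x => E ⟨k, x⟩, fun x y h => by
    have := E.injective h
    cases this; rfl⟩
  have himage : T.map ι₀ = S.filter fun j => (E.symm j).1 = k := by
    ext j
    rw [Finset.mem_map, Finset.mem_filter]
    constructor
    · rintro ⟨x, hx, rfl⟩
      exact ⟨(hmemT x).1 hx, by simp [ι₀]⟩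
    · rintro ⟨hj, hk⟩
      obtain ⟨⟨k', x⟩, rfl⟩ := E.surjective j
      rw [Equiv.symm_apply_apply] at hk
      subst hk
      exact ⟨x, (hmemT x).2 hj, rfl⟩
  rw [← himage, Finset.card_map]
  have e := Finset.card_toLeft_add_card_toRight (u := T)
  rw [hL, hR] at e
  omega

variable {d : ℕ}

/-- **The block permutations are transitive on the balanced `d`-sets with prescribed block counts**:
two sets of (reindexed) basis indices of the same size, each balanced in every symplectic pair and with
the same number of elements in every block, are exchanged by a block permutation `e^k_i ↦ e^k_{σ_k i}`,
`f^k_i ↦ f^k_{σ_k i}`. [cite: FultonHarris1991, §16.1] -/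
theorem exists_blockPerm_map_eq_of_balanced (s s' : Set.powersetCard (Fin N) d)
    (hs : ∀ (k : Fin m) (i : Fin (n k)), E ⟨k, Sum.inl i⟩ ∈ s ↔ E ⟨k, Sum.inr i⟩ ∈ s)
    (hs' : ∀ (k : Fin m) (i : Fin (n k)), E ⟨k, Sum.inl i⟩ ∈ s' ↔ E ⟨k, Sum.inr i⟩ ∈ s')
    (hcount : ∀ k, ((s : Finset (Fin N)).filter fun j => (E.symm j).1 = k).card =
      ((s' : Finset (Fin N)).filter fun j => (E.symm j).1 = k).card) :
    ∃ σ : ∀ k : Fin m, Equiv.Perm (Fin (n k)), Set.powersetCard.map d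
      (E.symm.trans ((Equiv.sigmaCongrRight fun k => (σ k).sumCongr (σ k)).trans E) : Fin N ≃ Fin N).toEmbedding s =
        s' := by
  classical
  have hS : ∀ k, (Finset.univ.filter fun i : Fin (n k) => E ⟨k, Sum.inl i⟩ ∈ (s : Finset (Fin N))).card =
      (Finset.univ.filter fun i : Fin (n k) => E ⟨k, Sum.inl i⟩ ∈ (s' : Finset (Fin N))).card := by
    intro k
    have e1 := two_mul_card_filter_eq_blockCount E k s (fun k i => hs k i)
    have e2 := two_mul_card_filter_eq_blockCount E k s' (fun k i => hs' k i)
    rw [hcount k] at e1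
    omega
  choose σ hσ using fun k => exists_perm_mem_iff_of_card_eq' (hS k)
  have hσ' : ∀ k i, E ⟨k, Sum.inl ((σ k).symm i)⟩ ∈ (s : Finset (Fin N)) ↔
      E ⟨k, Sum.inl i⟩ ∈ (s' : Finset (Fin N)) := by
    intro k i
    have e := hσ k ((σ k).symm i)
    rw [Equiv.apply_symm_apply, Finset.mem_filter, Finset.mem_filter, and_iff_right (Finset.mem_univ _),
      and_iff_right (Finset.mem_univ _)] at e
    exact e.symm
  refine ⟨σ, SetLike.ext fun j => ?_⟩
  rw [← Set.powersetCard.mem_coe_iff, Set.powersetCard.val_map, Finset.mem_map_equiv,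
    Set.powersetCard.mem_coe_iff]
  obtain ⟨a, rfl⟩ := E.surjective j
  rw [Equiv.symm_trans_apply, Equiv.symm_trans_apply, Equiv.symm_apply_apply]
  rcases a with ⟨k, i | i⟩
  · rw [sigmaCongrRight_sumCongr_symm_apply_inl, Equiv.symm_symm]
    exact (Set.powersetCard.mem_coe_iff.symm.trans (hσ' k i)).trans Set.powersetCard.mem_coe_iff
  · rw [sigmaCongrRight_sumCongr_symm_apply_inr, Equiv.symm_symm]
    have e1 := hs k ((σ k).symm i)
    have e2 := hs' k i
    rw [← e1, ← Set.powersetCard.mem_coe_iff, hσ' k i, Set.powersetCard.mem_coe_iff, e2]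

end Balanced

/-! ### §4 The weight / Weyl-group engine for several symplectic blocks -/

section Engine

variable {A : AbelianVariety ℂ} {m : ℕ} {n : Fin m → ℕ} {N : ℕ}
  (b₁ : Module.Basis (Σ k : Fin m, Fin (n k) ⊕ Fin (n k)) ℂ (complexBetti A.X 1))
  (E : (Σ k : Fin m, Fin (n k) ⊕ Fin (n k)) ≃ Fin N) {d : ℕ}
  (b : Module.Basis (Set.powersetCard (Fin N) d) ℂ (complexBetti A.X d))
  (hb : ∀ s, b s = cupPowOne ℂ (ComplexPoints A.X) d
    (fun j => (b₁.reindex E) (Set.powersetCard.ofFinEmbEquiv.symm s j)))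
  (G : Subgroup (complexBetti A.X 1 ≃ₗ[ℂ] complexBetti A.X 1))
  (htorus : ∀ (k : Fin m) (i : Fin (n k)), ∃ u ∈ G, ∃ dg : (Σ k : Fin m, Fin (n k) ⊕ Fin (n k)) → ℂ,
    (∀ a, u (b₁ a) = dg a • b₁ a) ∧
      ∀ s : Finset (Σ k : Fin m, Fin (n k) ⊕ Fin (n k)), ∏ a ∈ s, dg a = 1 →
        ((⟨k, Sum.inl i⟩ : Σ k : Fin m, Fin (n k) ⊕ Fin (n k)) ∈ s ↔ ⟨k, Sum.inr i⟩ ∈ s))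
include hb htorus

/-- **(S1) The torus confines supports to balanced sets**: if `x ∈ Hᵈ(A(ℂ); ℂ)` is fixed by `⋀ᵈu` for
every `u ∈ G`, and `G` contains the block torus cocharacters, then every `d`-set in the support of `x`
(cup-monomial basis on the block basis) is balanced in every symplectic pair `{e^k_i, f^k_i}`.
[cite: Milne1999LefschetzClasses, §3 Lemma 3.8 (proof)] [cite: FultonHarris1991, §16.1] -/
theorem balanced_of_repr_ne_zero {x : complexBetti A.X d}
    (hx : ∀ u ∈ G, exteriorPullback (AbelianVariety.hasExteriorCohomologyH1_complexPoints A)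
      (u : complexBetti A.X 1 →ₗ[ℂ] complexBetti A.X 1) d x = x)
    {s : Set.powersetCard (Fin N) d} (hs : b.repr x s ≠ 0) :
    ∀ (k : Fin m) (i : Fin (n k)), E ⟨k, Sum.inl i⟩ ∈ s ↔ E ⟨k, Sum.inr i⟩ ∈ s := by
  classical
  have hv : ∀ j, (b₁.reindex E) j = b₁ (E.symm j) := fun j => by rw [Module.Basis.reindex_apply]
  -- for the pair `(k, i)`
  have key : ∀ (k : Fin m) (i : Fin (n k)),
      E ⟨k, Sum.inl i⟩ ∈ s ↔ E ⟨k, Sum.inr i⟩ ∈ s := by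
    intro k i
    obtain ⟨u, huG, dg, hdg, hiff⟩ := htorus k i
    have hdiag : ∀ t, exteriorPullback (AbelianVariety.hasExteriorCohomologyH1_complexPoints A)
        (u : complexBetti A.X 1 →ₗ[ℂ] complexBetti A.X 1) d (b t) =
          (∏ j ∈ (t : Finset (Fin N)), dg (E.symm j)) • b t :=
      exteriorPullback_monomial_eq_prod_smul hb _ (fun j => by rw [LinearEquiv.coe_coe, hv, hdg])
    have h1 : ∏ j ∈ (s : Finset (Fin N)), dg (E.symm j) = 1 := by
      by_contra hne
      exact hs (repr_eq_zero_of_apply_eq_smul_of_apply_eq_self b hdiag (hx u huG) hne)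
    have h1' : ∏ a ∈ (s : Finset (Fin N)).map E.symm.toEmbedding, dg a = 1 := by
      rw [Finset.prod_map]; exact h1
    have h2 := hiff _ h1'
    rw [Finset.mem_map_equiv, Finset.mem_map_equiv, Equiv.symm_symm] at h2
    exact h2
  exact key

variable (hperm : ∀ σ : ∀ k : Fin m, Equiv.Perm (Fin (n k)), ∃ u ∈ G,
  ∀ a, u (b₁ a) = b₁ ((Equiv.sigmaCongrRight fun k => (σ k).sumCongr (σ k)) a))
include hperm

omit htorus in
/-- **(S2) The block permutations tie the coefficients along an orbit**: for an invariant `x`, two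
balanced `d`-sets with the same block counts have coordinates vanishing together.
[cite: FultonHarris1991, §16.1] [cite: Milne1999LefschetzClasses, §3 Prop. 3.6 (a)] -/
theorem repr_eq_zero_of_blockCount_eq {x : complexBetti A.X d}
    (hx : ∀ u ∈ G, exteriorPullback (AbelianVariety.hasExteriorCohomologyH1_complexPoints A)
      (u : complexBetti A.X 1 →ₗ[ℂ] complexBetti A.X 1) d x = x)
    (s s' : Set.powersetCard (Fin N) d)
    (hs : ∀ (k : Fin m) (i : Fin (n k)), E ⟨k, Sum.inl i⟩ ∈ s ↔ E ⟨k, Sum.inr i⟩ ∈ s)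
    (hs' : ∀ (k : Fin m) (i : Fin (n k)), E ⟨k, Sum.inl i⟩ ∈ s' ↔ E ⟨k, Sum.inr i⟩ ∈ s')
    (hcount : ∀ k, ((s : Finset (Fin N)).filter fun j => (E.symm j).1 = k).card =
      ((s' : Finset (Fin N)).filter fun j => (E.symm j).1 = k).card)
    (h0 : b.repr x s = 0) : b.repr x s' = 0 := by
  classical
  have hv : ∀ j, (b₁.reindex E) j = b₁ (E.symm j) := fun j => by rw [Module.Basis.reindex_apply]
  obtain ⟨σ, hσ⟩ := exists_blockPerm_map_eq_of_balanced E s s' hs hs' hcount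
  obtain ⟨u, huG, hu⟩ := hperm σ
  have he : ∀ j, (u : complexBetti A.X 1 →ₗ[ℂ] complexBetti A.X 1) ((b₁.reindex E) j) =
      (b₁.reindex E) ((E.symm.trans ((Equiv.sigmaCongrRight fun k => (σ k).sumCongr (σ k)).trans E)) j) :=
      fun j => by
    rw [LinearEquiv.coe_coe, hv, hu, hv, Equiv.trans_apply, Equiv.trans_apply, Equiv.symm_apply_apply]
  obtain ⟨ε, -, hε⟩ := exists_repr_map_eq_mul_repr_of_exteriorPullback_eq hb _ _ he (hx u huG) s
  rw [hσ, h0, mul_zero] at hε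
  exact hε

/-- **The engine for several symplectic blocks.** Let `G ≤ GL(H¹(A(ℂ); ℂ))` contain the block torus
cocharacters and the block permutations of a block basis `(e^k_i, f^k_i)`, and let `M ≤ Hᵈ(A(ℂ); ℂ)`.
Suppose that for every balanced `d`-set `s₀` of basis indices there is a NON-ZERO `G`-invariant class
`y ∈ M` supported on the `d`-sets with the same block counts as `s₀`. Then every `G`-invariant class of
`Hᵈ(A(ℂ); ℂ)` lies in `M`: its support is balanced (S1); subtracting the right multiple of the `y`
attached to a balanced set in the support kills the coordinates at ALL sets with those block counts (S2)
without touching the others; induction. [cite: Milne1999LefschetzClasses, §3 Prop. 3.6 (a) and p. 656]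
[cite: FultonHarris1991, §16.1 and Thm. 17.5] -/
theorem mem_of_forall_exteriorPullback_eq_of_blockBasis (M : Submodule ℂ (complexBetti A.X d))
    (hy : ∀ s₀ : Set.powersetCard (Fin N) d,
      (∀ (k : Fin m) (i : Fin (n k)), E ⟨k, Sum.inl i⟩ ∈ s₀ ↔ E ⟨k, Sum.inr i⟩ ∈ s₀) →
        ∃ y ∈ M, (∀ u ∈ G, exteriorPullback (AbelianVariety.hasExteriorCohomologyH1_complexPoints A)
          (u : complexBetti A.X 1 →ₗ[ℂ] complexBetti A.X 1) d y = y) ∧ y ≠ 0 ∧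
          ∀ s, b.repr y s ≠ 0 → ∀ k, ((s : Finset (Fin N)).filter fun j => (E.symm j).1 = k).card =
            ((s₀ : Finset (Fin N)).filter fun j => (E.symm j).1 = k).card)
    {x : complexBetti A.X d}
    (hx : ∀ u ∈ G, exteriorPullback (AbelianVariety.hasExteriorCohomologyH1_complexPoints A)
      (u : complexBetti A.X 1 →ₗ[ℂ] complexBetti A.X 1) d x = x) : x ∈ M := by
  classical
  -- induction on a finset `F` containing the support of `x`
  suffices H : ∀ (F : Finset (Set.powersetCard (Fin N) d)) (z : complexBetti A.X d),
      (∀ u ∈ G, exteriorPullback (AbelianVariety.hasExteriorCohomologyH1_complexPoints A)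
        (u : complexBetti A.X 1 →ₗ[ℂ] complexBetti A.X 1) d z = z) →
      (∀ s, s ∉ F → b.repr z s = 0) → z ∈ M from
    H Finset.univ x hx (fun s hs => absurd (Finset.mem_univ s) hs)
  intro F
  induction F using Finset.induction_on with
  | empty =>
    intro z _ hz
    have : z = 0 := b.repr.injective (Finsupp.ext fun s => by
      rw [hz s (Finset.notMem_empty s), map_zero, Finsupp.zero_apply])
    rw [this]
    exact M.zero_mem
  | insert s₀ F hs₀F ih =>
    intro z hz hzF
    by_cases hbal : ∀ (k : Fin m) (i : Fin (n k)), E ⟨k, Sum.inl i⟩ ∈ s₀ ↔ E ⟨k, Sum.inr i⟩ ∈ s₀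
    · -- subtract the right multiple of `y`
      obtain ⟨y, hyM, hyinv, hy0, hysupp⟩ := hy s₀ hbal
      obtain ⟨s₁, hs₁⟩ : ∃ s₁, b.repr y s₁ ≠ 0 := by
        by_contra hall
        push Not at hall
        exact hy0 (b.repr.injective (Finsupp.ext fun s => by rw [hall s, map_zero, Finsupp.zero_apply]))
      have hcount₁ := hysupp s₁ hs₁
      have hbal₁ := balanced_of_repr_ne_zero b₁ E b hb G htorus hyinv hs₁
      set c : ℂ := b.repr z s₁ / b.repr y s₁ with hc_def
      have hz' : ∀ u ∈ G, exteriorPullback (AbelianVariety.hasExteriorCohomologyH1_complexPoints A)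
          (u : complexBetti A.X 1 →ₗ[ℂ] complexBetti A.X 1) d (z - c • y) = z - c • y := fun u hu => by
        rw [map_sub, map_smul, hz u hu, hyinv u hu]
      have hz'₁ : b.repr (z - c • y) s₁ = 0 := by
        rw [map_sub, map_smul, Finsupp.sub_apply, Finsupp.smul_apply, smul_eq_mul, hc_def,
          div_mul_cancel₀ _ hs₁, sub_self]
      -- the coordinates of `z - c y` vanish outside `F`
      have hsupp : ∀ s, s ∉ F → b.repr (z - c • y) s = 0 := by
        intro s hsF
        by_cases hcs : ∀ k, ((s : Finset (Fin N)).filter fun j => (E.symm j).1 = k).card =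
            ((s₀ : Finset (Fin N)).filter fun j => (E.symm j).1 = k).card
        · -- same block counts as `s₀`: balanced or not
          by_cases hbs : ∀ (k : Fin m) (i : Fin (n k)), E ⟨k, Sum.inl i⟩ ∈ s ↔ E ⟨k, Sum.inr i⟩ ∈ s
          · exact repr_eq_zero_of_blockCount_eq b₁ E b hb G hperm hz' s₁ s hbal₁ hbs
              (fun k => (hcount₁ k).trans (hcs k).symm) hz'₁
          · by_contra hne
            exact hbs (balanced_of_repr_ne_zero b₁ E b hb G htorus hz' hne)
        · -- other block counts: `y` does not contribute, and `s ≠ s₀`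
          have hys : b.repr y s = 0 := by
            by_contra hne
            exact hcs (hysupp s hne)
          have hss₀ : s ≠ s₀ := by
            rintro rfl
            exact hcs fun k => rfl
          have hzs : b.repr z s = 0 := hzF s (by
            rw [Finset.mem_insert, not_or]
            exact ⟨hss₀, hsF⟩)
          rw [map_sub, map_smul, Finsupp.sub_apply, Finsupp.smul_apply, smul_eq_mul, hzs, hys, mul_zero,
            sub_zero]
      have hmem := ih (z - c • y) hz' hsupp
      have : z = (z - c • y) + c • y := by rw [sub_add_cancel]
      rw [this]
      exact M.add_mem hmem (M.smul_mem c hyM)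
    · -- `s₀` not balanced: its coordinate already vanishes
      refine ih z hz fun s hsF => ?_
      by_cases hss₀ : s = s₀
      · subst hss₀
        by_contra hne
        exact hbal (balanced_of_repr_ne_zero b₁ E b hb G htorus hz hne)
      · exact hzF s (by rw [Finset.mem_insert, not_or]; exact ⟨hss₀, hsF⟩)

end Engine

/-! ### §5 `⋀²` of a linear combination of endomorphisms of `H¹`, and the block components of a divisor class -/

section Quadratic

variable {A : AbelianVariety ℂ}

/-- **Polarization of `L ↦ ⋀²L`**: for endomorphisms `T_j` of `H¹(A(ℂ); ℂ)` and scalars `c_j`,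
`⋀²(Σ_j c_j T_j) = ½ Σ_i Σ_j c_i c_j (⋀²(T_i + T_j) - ⋀²T_i - ⋀²T_j)` on `H²(A(ℂ); ℂ) = ⋀²H¹` (both
sides send `u ∪ v` to `Σ_i Σ_j c_i c_j T_i u ∪ T_j v`). [cite: vanGeemen1994HodgeAV, 4.8]
[cite: LangeBirkenhake1992, Lemma 1.1.17] -/
theorem exteriorPullback_two_sum_smul {ι : Type} (s : Finset ι) (c : ι → ℂ)
    (T : ι → (complexBetti A.X 1 →ₗ[ℂ] complexBetti A.X 1)) (x : complexBetti A.X 2) :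
    exteriorPullback (AbelianVariety.hasExteriorCohomologyH1_complexPoints A) (∑ j ∈ s, c j • T j) 2 x =
      (2 : ℂ)⁻¹ • ∑ i ∈ s, ∑ j ∈ s, (c i * c j) •
        (exteriorPullback (AbelianVariety.hasExteriorCohomologyH1_complexPoints A) (T i + T j) 2 x -
          exteriorPullback (AbelianVariety.hasExteriorCohomologyH1_complexPoints A) (T i) 2 x -
          exteriorPullback (AbelianVariety.hasExteriorCohomologyH1_complexPoints A) (T j) 2 x) := by
  classical
  set hX := AbelianVariety.hasExteriorCohomologyH1_complexPoints A with hX_def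
  -- the right-hand side as a linear map
  set R : complexBetti A.X 2 →ₗ[ℂ] complexBetti A.X 2 :=
    (2 : ℂ)⁻¹ • ∑ i ∈ s, ∑ j ∈ s, (c i * c j) •
      (exteriorPullback hX (T i + T j) 2 - exteriorPullback hX (T i) 2 - exteriorPullback hX (T j) 2) with hR
  have hRx : R x = (2 : ℂ)⁻¹ • ∑ i ∈ s, ∑ j ∈ s, (c i * c j) •
      (exteriorPullback hX (T i + T j) 2 x - exteriorPullback hX (T i) 2 x - exteriorPullback hX (T j) 2 x) := by
    simp only [hR, LinearMap.smul_apply, LinearMap.sum_apply, LinearMap.sub_apply]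
  rw [← hRx]
  refine LinearMap.congr_fun (exteriorPullback_ext hX fun v => ?_) x
  -- evaluate both sides on `v 0 ∪ v 1`
  have hcup : cupPowOne ℂ (ComplexPoints A.X) 2 v = cupProduct (rfl : 1 + 1 = 2) (v 0) (v 1) := by
    rw [cupPowOne_succ, cupPowOne_one]
    rfl
  set F : ι → ι → complexBetti A.X 2 := fun i j => cupProduct (rfl : 1 + 1 = 2) (T i (v 0)) (T j (v 1))
    with hF
  have hpair : ∀ L L' : complexBetti A.X 1 →ₗ[ℂ] complexBetti A.X 1,
      exteriorPullback hX L 2 (cupPowOne ℂ (ComplexPoints A.X) 2 v) =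
        cupProduct (rfl : 1 + 1 = 2) (L (v 0)) (L (v 1)) := fun L L' => by
    rw [hcup, exteriorPullback_cupProduct_one_one]
  -- left-hand side
  have hL : exteriorPullback hX (∑ j ∈ s, c j • T j) 2 (cupPowOne ℂ (ComplexPoints A.X) 2 v) =
      ∑ i ∈ s, ∑ j ∈ s, (c i * c j) • F i j := by
    rw [hpair _ 0]
    simp only [LinearMap.sum_apply, LinearMap.smul_apply]
    rw [Literature.Barriers.HodgeConjecture.cupProduct_sum_smul_left]
    refine Finset.sum_congr rfl fun i _ => ?_
    rw [Literature.Barriers.HodgeConjecture.cupProduct_sum_smul_right, Finset.smul_sum]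
    refine Finset.sum_congr rfl fun j _ => ?_
    rw [smul_smul]
  -- the three terms of the right-hand side
  have hR' : R (cupPowOne ℂ (ComplexPoints A.X) 2 v) =
      (2 : ℂ)⁻¹ • ∑ i ∈ s, ∑ j ∈ s, (c i * c j) • (F i j + F j i) := by
    simp only [hR, LinearMap.smul_apply, LinearMap.sum_apply, LinearMap.sub_apply]
    congr 1
    refine Finset.sum_congr rfl fun i _ => Finset.sum_congr rfl fun j _ => ?_
    congr 1
    rw [hpair _ 0, hpair _ 0, hpair _ 0]
    simp only [LinearMap.add_apply, map_add, hF]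
    abel
  have hsymm : ∑ i ∈ s, ∑ j ∈ s, (c i * c j) • F j i = ∑ i ∈ s, ∑ j ∈ s, (c i * c j) • F i j := by
    rw [Finset.sum_comm]
    refine Finset.sum_congr rfl fun i _ => Finset.sum_congr rfl fun j _ => ?_
    rw [mul_comm]
  rw [hL, hR']
  simp only [smul_add, Finset.sum_add_distrib]
  rw [hsymm, ← two_smul ℂ, smul_smul, mul_inv_cancel₀ (two_ne_zero' ℂ), one_smul]

/-- Consequence: if `⋀²T_i x` and `⋀²(T_i + T_j) x` all lie in a subspace `D ≤ H²(A(ℂ); ℂ)`, so does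
`⋀²(Σ_j c_j T_j) x`. [cite: vanGeemen1994HodgeAV, 4.8] -/
theorem exteriorPullback_two_sum_smul_mem {ι : Type} (s : Finset ι) (c : ι → ℂ)
    (T : ι → (complexBetti A.X 1 →ₗ[ℂ] complexBetti A.X 1)) (x : complexBetti A.X 2)
    (D : Submodule ℂ (complexBetti A.X 2))
    (h1 : ∀ i ∈ s, exteriorPullback (AbelianVariety.hasExteriorCohomologyH1_complexPoints A) (T i) 2 x ∈ D)
    (h2 : ∀ i ∈ s, ∀ j ∈ s,
      exteriorPullback (AbelianVariety.hasExteriorCohomologyH1_complexPoints A) (T i + T j) 2 x ∈ D) :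
    exteriorPullback (AbelianVariety.hasExteriorCohomologyH1_complexPoints A) (∑ j ∈ s, c j • T j) 2 x ∈ D := by
  rw [exteriorPullback_two_sum_smul]
  refine D.smul_mem _ (Submodule.sum_mem _ fun i hi => Submodule.sum_mem _ fun j hj => D.smul_mem _ ?_)
  exact D.sub_mem (D.sub_mem (h2 i hi j hj) (h1 i hi)) (h1 j hj)

/-- **Pull-backs along endomorphisms of `A` preserve `B¹(A) ⊗ ℂ`**, in the form `⋀²(ψ^*|_{H¹}) x ∈ B¹ ⊗ ℂ`
for `x ∈ B¹ ⊗ ℂ` (`⋀•(ψ^*|_{H¹}) = ψ^*`, Hatcher Prop. 3.10, and `ψ^*` preserves rationality and the Hodge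
type). [cite: HatcherAT2002, §3.2 Prop. 3.10] [cite: vanGeemen1994HodgeAV, 4.8] -/
theorem exteriorPullback_pullbackOne_mem_hodgeClassSpan_one (ψ : A ⟶ A) {x : complexBetti A.X 2}
    (hx : x ∈ hodgeClassSpan A.dim A.X 1) :
    exteriorPullback (AbelianVariety.hasExteriorCohomologyH1_complexPoints A) (pullbackOne A ψ) 2 x ∈
      hodgeClassSpan A.dim A.X 1 := by
  have e : exteriorPullback (AbelianVariety.hasExteriorCohomologyH1_complexPoints A) (pullbackOne A ψ) 2 x =
      complexBetti.map ψ.hom.hom.hom 2 x :=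
    exteriorPullback_map_apply (AbelianVariety.hasExteriorCohomologyH1_complexPoints A) _ 2 x
  rw [e]
  exact map_mem_hodgeClassSpan_one ψ hx

/-- `ψ^* + ψ'^* = (ψ + ψ')^*` on `H¹(A(ℂ); ℂ)` (pull-back is additive on `H¹` of an abelian variety).
[cite: MumfordAV1970, §1] [cite: LangeBirkenhake1992, §1.2] -/
theorem pullbackOne_add (ψ ψ' : A ⟶ A) : pullbackOne A (ψ + ψ') = pullbackOne A ψ + pullbackOne A ψ' := by
  refine LinearMap.ext fun v => ?_
  rw [LinearMap.add_apply]
  exact complexBetti_map_add_deg_one ψ ψ' v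

/-- The powers of `φ^*` are pull-backs along endomorphisms of `A` (`(φ^*)^j = (φ^j)^*`, `H¹` contravariant).
[cite: LangeBirkenhake1992, §1.2] -/
theorem exists_pullbackOne_eq_pow (φ : A ⟶ A) (j : ℕ) : ∃ ψ : A ⟶ A, pullbackOne A ψ = pullbackOne A φ ^ j := by
  induction j with
  | zero =>
    refine ⟨𝟙 A, LinearMap.ext fun v => ?_⟩
    rw [pow_zero, Module.End.one_apply]
    change complexBetti.map (𝟙 A.X) 1 v = v
    rw [complexBetti.map_id]
    rfl
  | succ j ih =>
    obtain ⟨ψ, hψ⟩ := ih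
    refine ⟨φ ≫ ψ, LinearMap.ext fun v => ?_⟩
    rw [pow_succ', Module.End.mul_apply, ← hψ]
    exact (complexBetti_map_map_hom φ ψ v).symm

/-- **`⋀²(q(φ^*)) (B¹ ⊗ ℂ) ⊆ B¹ ⊗ ℂ` for every complex polynomial `q`**: `q(φ^*) = Σ_j q_j (φ^j)^*`, and by
polarization `⋀²(Σ_j q_j (φ^j)^*) x` is a `ℂ`-combination of the classes `(φ^j)^* x` and
`(φ^i + φ^j)^* x ∈ B¹ ⊗ ℚ` (Milne p. 646: the idempotents `e_i` of `F ⊗ k` are polynomials in a generator).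
[cite: Milne1999LefschetzClasses, §2 p. 646] [cite: vanGeemen1994HodgeAV, 4.8] -/
theorem exteriorPullback_aeval_pullbackOne_mem_hodgeClassSpan_one (φ : A ⟶ A) (q : ℂ[X])
    {x : complexBetti A.X 2} (hx : x ∈ hodgeClassSpan A.dim A.X 1) :
    exteriorPullback (AbelianVariety.hasExteriorCohomologyH1_complexPoints A) (aeval (pullbackOne A φ) q)
      2 x ∈ hodgeClassSpan A.dim A.X 1 := by
  classical
  choose ψ hψ using exists_pullbackOne_eq_pow (A := A) φ
  have haeval : (aeval (pullbackOne A φ) q : complexBetti A.X 1 →ₗ[ℂ] complexBetti A.X 1) =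
      ∑ j ∈ Finset.range (q.natDegree + 1), q.coeff j • pullbackOne A (ψ j) := by
    rw [aeval_eq_sum_range]
    simp only [← hψ]
  rw [haeval]
  refine exteriorPullback_two_sum_smul_mem _ _ _ x _ (fun i _ => ?_) (fun i _ j _ => ?_)
  · exact exteriorPullback_pullbackOne_mem_hodgeClassSpan_one (ψ i) hx
  · rw [← pullbackOne_add]
    exact exteriorPullback_pullbackOne_mem_hodgeClassSpan_one (ψ i + ψ j) hx

end Quadratic

section Projector

variable {A : AbelianVariety ℂ} {m : ℕ} {n : Fin m → ℕ}
  (b₁ : Module.Basis (Σ k : Fin m, Fin (n k) ⊕ Fin (n k)) ℂ (complexBetti A.X 1))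
  (φ : A ⟶ A) {μ : Fin m → ℂ} (hμ : Function.Injective μ)
  (hJ : ∀ a, pullbackOne A φ (b₁ a) = μ a.1 • b₁ a)
include hμ hJ

/-- **The block projectors are polynomials in `φ^*`, hence preserve `B¹ ⊗ ℂ` under `⋀²`**: for every block
`k` there is an endomorphism `P_k` of `H¹(A(ℂ); ℂ)` (the Lagrange interpolation polynomial of the
eigenvalue `μ_k` evaluated at `φ^*`: Milne's idempotent `e_i` of `F ⊗ k`, p. 646) which is the identity on
block `k` and zero on the other blocks, with `⋀²P_k (B¹ ⊗ ℂ) ⊆ B¹ ⊗ ℂ`.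
[cite: Milne1999LefschetzClasses, §2 p. 646 (`1 = e₁ + ⋯ + e_t`, `V_i = e_i V`)] -/
theorem exists_blockProjector (k : Fin m) :
    ∃ P : complexBetti A.X 1 →ₗ[ℂ] complexBetti A.X 1,
      (∀ a, P (b₁ a) = (if a.1 = k then (1 : ℂ) else 0) • b₁ a) ∧
      ∀ x ∈ hodgeClassSpan A.dim A.X 1,
        exteriorPullback (AbelianVariety.hasExteriorCohomologyH1_complexPoints A) P 2 x ∈ hodgeClassSpan A.dim A.X 1 := by
  classical
  refine ⟨(aeval (pullbackOne A φ) (Lagrange.basis Finset.univ μ k) :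
      complexBetti A.X 1 →ₗ[ℂ] complexBetti A.X 1), fun a => ?_,
    fun x hx => exteriorPullback_aeval_pullbackOne_mem_hodgeClassSpan_one φ _ hx⟩
  have hev : (pullbackOne A φ).HasEigenvector (μ a.1) (b₁ a) :=
    Module.End.hasEigenvector_iff.2 ⟨Module.End.mem_eigenspace_iff.2 (hJ a), b₁.ne_zero a⟩
  rw [Module.End.aeval_apply_of_hasEigenvector hev]
  congr 1
  by_cases hk : a.1 = k
  · rw [if_pos hk, ← hk]
    exact Lagrange.eval_basis_self hμ.injOn (Finset.mem_univ _)
  · rw [if_neg hk]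
    exact Lagrange.eval_basis_of_ne (Ne.symm hk) (Finset.mem_univ _)

end Projector

/-! ### §5b Coordinates of `⋀ᵈL x` for a diagonal `L`; balanced `2`-sets; the block decomposition of a class -/

section Diagonal

variable {A : AbelianVariety ℂ} {m : ℕ} {n : Fin m → ℕ} {N : ℕ}
  (b₁ : Module.Basis (Σ k : Fin m, Fin (n k) ⊕ Fin (n k)) ℂ (complexBetti A.X 1))
  (E : (Σ k : Fin m, Fin (n k) ⊕ Fin (n k)) ≃ Fin N) {d : ℕ}
  (b : Module.Basis (Set.powersetCard (Fin N) d) ℂ (complexBetti A.X d))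
  (hb : ∀ s, b s = cupPowOne ℂ (ComplexPoints A.X) d
    (fun j => (b₁.reindex E) (Set.powersetCard.ofFinEmbEquiv.symm s j)))
include hb

/-- **Coordinates of `⋀ᵈL x` for `L` diagonal on the block basis**: `(⋀ᵈL x)_s = (∏_{j ∈ s} χ_j) · x_s`.
[cite: Milne1999LefschetzClasses, §3 Lemma 3.8 (proof)] -/
theorem repr_exteriorPullback_of_diag (L : complexBetti A.X 1 →ₗ[ℂ] complexBetti A.X 1)
    {χ : (Σ k : Fin m, Fin (n k) ⊕ Fin (n k)) → ℂ} (hL : ∀ a, L (b₁ a) = χ a • b₁ a)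
    (x : complexBetti A.X d) (s : Set.powersetCard (Fin N) d) :
    b.repr (exteriorPullback (AbelianVariety.hasExteriorCohomologyH1_complexPoints A) L d x) s =
      (∏ j ∈ (s : Finset (Fin N)), χ (E.symm j)) * b.repr x s := by
  classical
  have hv : ∀ j, (b₁.reindex E) j = b₁ (E.symm j) := fun j => by rw [Module.Basis.reindex_apply]
  have hdiag : ∀ t, exteriorPullback (AbelianVariety.hasExteriorCohomologyH1_complexPoints A) L d (b t) =
      (∏ j ∈ (t : Finset (Fin N)), χ (E.symm j)) • b t :=
    exteriorPullback_monomial_eq_prod_smul hb L (fun j => by rw [hv, hL])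
  have key : (b.coord s).comp (exteriorPullback (AbelianVariety.hasExteriorCohomologyH1_complexPoints A) L d) =
      (∏ j ∈ (s : Finset (Fin N)), χ (E.symm j)) • b.coord s := by
    refine b.ext fun t => ?_
    simp only [LinearMap.comp_apply, LinearMap.smul_apply, Module.Basis.coord_apply, hdiag t, map_smul,
      Module.Basis.repr_self, Finsupp.single_apply, smul_eq_mul]
    by_cases hts : t = s
    · subst hts; simp
    · simp [hts]
  have e := LinearMap.congr_fun key x
  rw [LinearMap.comp_apply, Module.Basis.coord_apply, LinearMap.smul_apply, Module.Basis.coord_apply,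
    smul_eq_mul] at e
  exact e

omit hb in
/-- **A `2`-set of basis indices balanced in every symplectic pair is one pair `{e^k_i, f^k_i}`**; in
particular it lies in one block (Lemma 3.8 with `n = 2`: "`[Σ] = 0 ⟹ V(Σ) = ⊗ (V_{ξᵢ} ⊗ V_{ξ_{m+i}})^{⊗nᵢ}`").
[cite: Milne1999LefschetzClasses, §3 Lemma 3.8] -/
theorem exists_forall_fst_eq_of_balanced_two (s : Set.powersetCard (Fin N) 2)
    (hs : ∀ (k : Fin m) (i : Fin (n k)), E ⟨k, Sum.inl i⟩ ∈ s ↔ E ⟨k, Sum.inr i⟩ ∈ s) :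
    ∃ k₀ : Fin m, ∀ j ∈ (s : Finset (Fin N)), (E.symm j).1 = k₀ := by
  classical
  have hcard : (s : Finset (Fin N)).card = 2 := Set.powersetCard.card_eq s
  obtain ⟨j₁, j₂, hne, hs12⟩ := Finset.card_eq_two.1 hcard
  refine ⟨(E.symm j₁).1, fun j hj => ?_⟩
  have hj₁ : j₁ ∈ s := by
    rw [← Set.powersetCard.mem_coe_iff, hs12]
    exact Finset.mem_insert_self _ _
  -- the symplectic partner of `j₁` lies in `s`, differs from `j₁`, and has the same block
  have hpartner : ∃ j', j' ∈ s ∧ j' ≠ j₁ ∧ (E.symm j').1 = (E.symm j₁).1 := by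
    rcases hE : E.symm j₁ with ⟨k, i | i⟩
    · have hj₁' : j₁ = E ⟨k, Sum.inl i⟩ := by rw [← hE, Equiv.apply_symm_apply]
      refine ⟨E ⟨k, Sum.inr i⟩, (hs k i).1 (hj₁' ▸ hj₁), fun h => ?_, by rw [Equiv.symm_apply_apply]⟩
      have h' := E.injective (h.trans hj₁')
      simp at h'
    · have hj₁' : j₁ = E ⟨k, Sum.inr i⟩ := by rw [← hE, Equiv.apply_symm_apply]
      refine ⟨E ⟨k, Sum.inl i⟩, (hs k i).2 (hj₁' ▸ hj₁), fun h => ?_, by rw [Equiv.symm_apply_apply]⟩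
      have h' := E.injective (h.trans hj₁')
      simp at h'
  obtain ⟨j', hj's, hj'ne, hj'k⟩ := hpartner
  rw [← Set.powersetCard.mem_coe_iff, hs12, Finset.mem_insert, Finset.mem_singleton] at hj's
  rcases hj's with h | h
  · exact absurd h hj'ne
  · rw [hs12, Finset.mem_insert, Finset.mem_singleton] at hj
    rcases hj with rfl | rfl
    · rfl
    · rw [← h, hj'k]

end Diagonal

/-! ### §6 Products of degree-`2` classes along words -/

section Words

variable {m : ℕ}

/-- Two words with the same letter counts differ by a permutation of the positions. [folklore] -/
private theorem exists_perm_of_card_filter_eq {q : ℕ} (w w' : Fin q → Fin m)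
    (h : ∀ k, (Finset.univ.filter fun i => w i = k).card = (Finset.univ.filter fun i => w' i = k).card) :
    ∃ σ : Equiv.Perm (Fin q), ∀ i, w' i = w (σ i) := by
  classical
  have hc : ∀ k, Fintype.card {i // w' i = k} = Fintype.card {i // w i = k} := fun k => by
    rw [Fintype.card_subtype, Fintype.card_subtype, h k]
  let e : ∀ k, {i // w' i = k} ≃ {i // w i = k} := fun k => Fintype.equivOfCardEq (hc k)
  refine ⟨(Equiv.sigmaFiberEquiv w').symm.trans ((Equiv.sigmaCongrRight e).trans (Equiv.sigmaFiberEquiv w)),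
    fun i => ?_⟩
  simp only [Equiv.trans_apply, Equiv.sigmaCongrRight_apply]
  exact ((e (w' i) ⟨i, rfl⟩).2).symm

/-- The letter counts of a word of length `q` add up to `q`. [folklore] -/
private theorem sum_card_filter_eq {q : ℕ} (w : Fin q → Fin m) :
    ∑ k, (Finset.univ.filter fun i => w i = k).card = q := by
  classical
  have e := Finset.card_eq_sum_card_fiberwise (f := w) (s := Finset.univ) (t := Finset.univ)
    (fun i _ => Finset.mem_univ _)
  rw [Finset.card_univ, Fintype.card_fin] at e
  exact e.symm

/-- The letter counts of a juxtaposition `w ∗ v` are the sums of the letter counts. [folklore] -/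
private theorem card_filter_append {p r : ℕ} (w : Fin p → Fin m) (v : Fin r → Fin m) (k : Fin m) :
    (Finset.univ.filter fun i => Fin.append w v i = k).card =
      (Finset.univ.filter fun i => w i = k).card + (Finset.univ.filter fun i => v i = k).card := by
  classical
  simp only [Finset.card_filter]
  rw [Fin.sum_univ_add]
  simp only [Fin.append_left, Fin.append_right]

/-- The letter counts of a word peel off at the last letter. [folklore] -/
private theorem card_filter_succ {q : ℕ} (w : Fin (q + 1) → Fin m) (k : Fin m) :
    (Finset.univ.filter fun i => w i = k).card =
      (Finset.univ.filter fun i : Fin q => w (Fin.castSucc i) = k).card + (if w (Fin.last q) = k then 1 else 0) := by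
  classical
  simp only [Finset.card_filter]
  rw [Fin.sum_univ_castSucc]

/-- **A word with prescribed letter counts**: `c_0` copies of `0`, then `c_1` copies of `1`, ….
[folklore] -/
private theorem card_filter_sigmaWord (c : Fin m → ℕ) (k : Fin m) :
    (Finset.univ.filter fun i : Fin (∑ k, c k) => (finSigmaFinEquiv.symm i).1 = k).card = c k := by
  classical
  -- transport along `finSigmaFinEquiv`
  have h1 : (Finset.univ.filter fun i : Fin (∑ k, c k) => (finSigmaFinEquiv.symm i).1 = k) =
      (Finset.univ.filter fun x : (Σ k : Fin m, Fin (c k)) => x.1 = k).map finSigmaFinEquiv.toEmbedding := by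
    ext i
    simp only [Finset.mem_filter, Finset.mem_univ, true_and, Finset.mem_map_equiv]
  rw [h1, Finset.card_map]
  have h2 : (Finset.univ.filter fun x : (Σ k : Fin m, Fin (c k)) => x.1 = k) =
      ({k} : Finset (Fin m)).sigma fun k' => (Finset.univ : Finset (Fin (c k'))) := by
    ext ⟨k', i⟩
    simp only [Finset.mem_filter, Finset.mem_univ, true_and, Finset.mem_sigma, Finset.mem_singleton, and_true]
  rw [h2, Finset.card_sigma, Finset.sum_singleton, Finset.card_univ, Fintype.card_fin]

end Words

section WordProd

variable {A : AbelianVariety ℂ} {m : ℕ} (ω : Fin m → complexBetti A.X 2)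
  (Y : ∀ q : ℕ, (Fin q → Fin m) → complexBetti A.X (2 * q))
  (hY0 : ∀ w, Y 0 w = singularCohomology.one ℂ (ComplexPoints A.X))
  (hYs : ∀ (q : ℕ) (w : Fin (q + 1) → Fin m),
    Y (q + 1) w = cupProduct (two_mul_add_two q) (Y q (Fin.init w)) (ω (w (Fin.last q))))
include hY0 hYs

/-- **Products of classes of `B¹ ⊗ ℂ` along a word lie in `D^q ⊗ ℂ`** (the divisor span is closed under
right multiplication by `B¹ ⊗ ℂ`). [cite: vanGeemen1994HodgeAV, §2.4] -/
theorem wordProd_mem_divisorClassesSpan (hω : ∀ k, ω k ∈ hodgeClassSpan A.dim A.X 1) :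
    ∀ (q : ℕ) (w : Fin q → Fin m), Y q w ∈ divisorClassesSpan A.X A.dim q
  | 0, w => by
    rw [hY0]
    exact Submodule.subset_span (mem_divisorMonomials_zero.2 rfl)
  | q + 1, w => by
    rw [hYs]
    exact cupProduct_mem_divisorClassesSpan_succ _ (wordProd_mem_divisorClassesSpan hω q _) (hω _)

omit hY0 hYs in
/-- `(X ∪ a) ∪ c = (X ∪ c) ∪ a` for classes `a, c` of degree `2` (associativity and graded commutativity in
even degrees). [cite: HatcherAT2002, §3.2 Thm. 3.11] -/
theorem cupProduct_cupProduct_swap_two {q : ℕ} (X : complexBetti A.X (2 * q)) (a c : complexBetti A.X 2) :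
    cupProduct (two_mul_add_two (q + 1)) (cupProduct (two_mul_add_two q) X a) c =
      cupProduct (two_mul_add_two (q + 1)) (cupProduct (two_mul_add_two q) X c) a := by
  have h4 : 2 * q + (2 + 2) = 2 * (q + 1 + 1) := by ring
  rw [cupProduct_assoc (two_mul_add_two q) (rfl : 2 + 2 = 2 + 2) (two_mul_add_two (q + 1)) h4,
    cupProduct_assoc (two_mul_add_two q) (rfl : 2 + 2 = 2 + 2) (two_mul_add_two (q + 1)) h4,
    cupProduct_gradedComm_holds ℂ (ComplexPoints A.X) (rfl : 2 + 2 = 2 + 2) rfl a c]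
  norm_num

/-- **Extraction of a letter**: the product along a word equals the product along the word with the
letter at position `j` removed, times that letter (the degree-`2` classes commute past each other).
[cite: HatcherAT2002, §3.2 Thm. 3.11] -/
theorem wordProd_eq_succAbove : ∀ (q : ℕ) (w : Fin (q + 1) → Fin m) (j : Fin (q + 1)),
    Y (q + 1) w = cupProduct (two_mul_add_two q) (Y q (fun i => w (j.succAbove i))) (ω (w j))
  | 0, w, j => by
    obtain ⟨j, hjlt⟩ := j
    have hj0 : j = 0 := by omega
    subst hj0
    rw [hYs, hY0, hY0]
    rfl
  | q + 1, w, j => by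
    by_cases hj : j = Fin.last (q + 1)
    · subst hj
      rw [hYs]
      have : (fun i => w ((Fin.last (q + 1)).succAbove i)) = Fin.init w :=
        funext fun i => by rw [Fin.succAbove_last_apply]; rfl
      rw [this]
    · obtain ⟨j', rfl⟩ := Fin.eq_castSucc_of_ne_last hj
      rw [hYs (q + 1) w, wordProd_eq_succAbove q (Fin.init w) j', cupProduct_cupProduct_swap_two,
        hYs q (fun i => w ((Fin.castSucc j').succAbove i))]
      have h1 : Fin.init (fun i => w ((Fin.castSucc j').succAbove i)) = fun i => Fin.init w (j'.succAbove i) := by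
        funext i
        simp only [Fin.init, Fin.castSucc_succAbove_castSucc]
      have h2 : w ((Fin.castSucc j').succAbove (Fin.last q)) = w (Fin.last (q + 1)) := by
        rw [Fin.succAbove_of_le_castSucc _ _ (Fin.castSucc_le_castSucc_iff.2 (Fin.le_last j')), Fin.succ_last]
      rw [h1, h2]
      rfl

/-- **The product along a word depends only on the letters, not on their order.**
[cite: HatcherAT2002, §3.2 Thm. 3.11] -/
theorem wordProd_comp_perm : ∀ (q : ℕ) (w : Fin q → Fin m) (σ : Equiv.Perm (Fin q)),
    Y q (fun i => w (σ i)) = Y q w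
  | 0, w, σ => by rw [hY0, hY0]
  | q + 1, w, σ => by
    set j₀ : Fin (q + 1) := σ.symm (Fin.last q) with hj₀
    have hσj : σ j₀ = Fin.last q := σ.apply_symm_apply _
    rw [wordProd_eq_succAbove ω Y hY0 hYs q (fun i => w (σ i)) j₀, hYs q w]
    have hne : ∀ i, σ (j₀.succAbove i) ≠ Fin.last q := fun i h =>
      Fin.succAbove_ne j₀ i (σ.injective (h.trans hσj.symm))
    let τf : Fin q → Fin q := fun i => (σ (j₀.succAbove i)).castPred (hne i)
    have hτinj : Function.Injective τf := by
      intro i i' h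
      have h' := congrArg Fin.castSucc h
      simp only [τf, Fin.castSucc_castPred] at h'
      exact Fin.succAbove_right_injective (σ.injective h')
    let τ : Equiv.Perm (Fin q) := Equiv.ofBijective τf hτinj.bijective_of_finite
    have hw : (fun i => w (σ (j₀.succAbove i))) = fun i => Fin.init w (τ i) := by
      funext i
      simp only [Fin.init, τ, Equiv.ofBijective_apply, τf, Fin.castSucc_castPred]
    simp only [hw, wordProd_comp_perm q (Fin.init w) τ, hσj]

/-- **Expansion of a power of a sum into products along words**: `(Σ_k ω_k)^q = Σ_{w : [q] → [m]} ω_w`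
(multilinearity of the cup product; no commutation needed). [cite: HatcherAT2002, §3.2] -/
theorem cupPowTwo_sum_eq_sum_wordProd : ∀ q : ℕ, cupPowTwo (∑ k, ω k) q = ∑ w : Fin q → Fin m, Y q w
  | 0 => by
    rw [cupPowTwo_zero, Fintype.sum_unique, hY0]
  | q + 1 => by
    classical
    rw [cupPowTwo_succ, cupPowTwo_sum_eq_sum_wordProd q]
    have hL : cupProduct (two_mul_add_two q) (∑ w : Fin q → Fin m, Y q w) (∑ k, ω k) =
        ∑ k, ∑ w : Fin q → Fin m, cupProduct (two_mul_add_two q) (Y q w) (ω k) := by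
      rw [map_sum]
      refine Finset.sum_congr rfl fun k _ => ?_
      rw [map_sum, LinearMap.sum_apply]
    rw [hL]
    conv_rhs => rw [← (Fin.snocEquiv fun _ => Fin m).sum_comp, Fintype.sum_prod_type]
    refine Finset.sum_congr rfl fun k _ => Finset.sum_congr rfl fun w _ => ?_
    rw [hYs]
    simp [Fin.snocEquiv, Fin.init_snoc, Fin.snoc_last]

omit hY0 in
/-- If the product along `w` vanishes, so does the product along every juxtaposition `w ∗ v`.
[cite: HatcherAT2002, §3.2] -/
theorem wordProd_append_eq_zero {p : ℕ} {w : Fin p → Fin m} (hw : Y p w = 0) :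
    ∀ (r : ℕ) (v : Fin r → Fin m), Y (p + r) (Fin.append w v) = 0
  | 0, v => by
    have : (Fin.append w v : Fin (p + 0) → Fin m) = w := by
      rw [Fin.append_right_nil w v rfl]
      funext i
      simp
    rw [this]
    exact hw
  | r + 1, v => by
    have hv : v = Fin.snoc (Fin.init v) (v (Fin.last r)) := (Fin.snoc_init_self v).symm
    rw [hv, Fin.append_snoc]
    change Y (p + r + 1) _ = 0
    rw [hYs (p + r)]
    simp only [Fin.init_snoc]
    rw [wordProd_append_eq_zero hw r, map_zero, LinearMap.zero_apply]

end WordProd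

section WordSupport

variable {A : AbelianVariety ℂ} {m : ℕ} {n : Fin m → ℕ} {N : ℕ}
  (b₁ : Module.Basis (Σ k : Fin m, Fin (n k) ⊕ Fin (n k)) ℂ (complexBetti A.X 1))
  (E : (Σ k : Fin m, Fin (n k) ⊕ Fin (n k)) ≃ Fin N)
  (bb : ∀ d : ℕ, Module.Basis (Set.powersetCard (Fin N) d) ℂ (complexBetti A.X d))
  (hbb : ∀ d s, bb d s = cupPowOne ℂ (ComplexPoints A.X) d
    (fun j => (b₁.reindex E) (Set.powersetCard.ofFinEmbEquiv.symm s j)))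
include hbb

/-- **Supports multiply**: a non-zero coordinate of `x ∪ z` sits at the union of a set in the support of
`x` and a set in the support of `z` (`[T] ∪ [U] = ± [T ⊔ U]` or `0`). [cite: Hazama2003GHCCM, (4.C)/(4.1) p. 631]
[cite: HatcherAT2002, §3.2] -/
theorem exists_of_repr_cupProduct_ne_zero {d e c : ℕ} (h : d + e = c) (x : complexBetti A.X d)
    (z : complexBetti A.X e) (S : Set.powersetCard (Fin N) c) (hS : (bb c).repr (cupProduct h x z) S ≠ 0) :
    ∃ (T : Set.powersetCard (Fin N) d) (U : Set.powersetCard (Fin N) e),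
      (bb d).repr x T ≠ 0 ∧ (bb e).repr z U ≠ 0 ∧ (S : Finset (Fin N)) = (T : Finset (Fin N)) ∪ (U : Finset (Fin N)) := by
  classical
  by_contra hcon
  push Not at hcon
  apply hS
  rw [← (bb d).sum_repr x, Literature.Barriers.HodgeConjecture.cupProduct_sum_smul_left, map_sum,
    Finsupp.finsetSum_apply]
  refine Finset.sum_eq_zero fun T _ => ?_
  rw [map_smul, Finsupp.smul_apply, smul_eq_mul]
  by_cases hT : (bb d).repr x T = 0
  · rw [hT, zero_mul]
  rw [← (bb e).sum_repr z, Literature.Barriers.HodgeConjecture.cupProduct_sum_smul_right, map_sum,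
    Finsupp.finsetSum_apply]
  refine mul_eq_zero_of_right _ (Finset.sum_eq_zero fun U _ => ?_)
  rw [map_smul, Finsupp.smul_apply, smul_eq_mul]
  by_cases hU : (bb e).repr z U = 0
  · rw [hU, zero_mul]
  rw [Literature.Barriers.HodgeConjecture.repr_cupProduct_monomial_eq_zero (b₁.reindex E) h (hbb d) (hbb e)
    (hbb c) T U (hcon T U hT hU), mul_zero]

omit hbb in
/-- The number of basis indices in block `k` is `2 n_k`. [folklore] -/
private theorem card_filter_fst_eq (k : Fin m) :
    ((Finset.univ : Finset (Fin N)).filter fun j => (E.symm j).1 = k).card = 2 * n k := by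
  classical
  let ι₀ : (Fin (n k) ⊕ Fin (n k)) ↪ Fin N := ⟨fun x => E ⟨k, x⟩, fun x y h => by
    have := E.injective h
    cases this; rfl⟩
  have himage : (Finset.univ : Finset (Fin (n k) ⊕ Fin (n k))).map ι₀ =
      (Finset.univ : Finset (Fin N)).filter fun j => (E.symm j).1 = k := by
    ext j
    rw [Finset.mem_map, Finset.mem_filter]
    constructor
    · rintro ⟨x, -, rfl⟩
      exact ⟨Finset.mem_univ _, by simp [ι₀]⟩
    · rintro ⟨-, hk⟩
      obtain ⟨⟨k', x⟩, rfl⟩ := E.surjective j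
      rw [Equiv.symm_apply_apply] at hk
      subst hk
      exact ⟨x, Finset.mem_univ _, rfl⟩
  rw [← himage, Finset.card_map, Finset.card_univ, Fintype.card_sum, Fintype.card_fin]
  ring

variable (ω : Fin m → complexBetti A.X 2)
  (Y : ∀ q : ℕ, (Fin q → Fin m) → complexBetti A.X (2 * q))
  (hY0 : ∀ w, Y 0 w = singularCohomology.one ℂ (ComplexPoints A.X))
  (hYs : ∀ (q : ℕ) (w : Fin (q + 1) → Fin m),
    Y (q + 1) w = cupProduct (two_mul_add_two q) (Y q (Fin.init w)) (ω (w (Fin.last q))))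
  (hω : ∀ (k : Fin m) (s : Set.powersetCard (Fin N) 2), (bb 2).repr (ω k) s ≠ 0 →
    ∀ j ∈ (s : Finset (Fin N)), (E.symm j).1 = k)
include hY0 hYs hω

omit hY0 in
/-- **The support of a product along a word has the word's block counts**: if the `ω_k` are supported on
the `2`-sets inside block `k`, a set in the support of `ω_w` meets block `k` in exactly `2 · #w⁻¹(k)`
indices. [cite: Milne1999LefschetzClasses, §3 proof of Prop. 3.6 (`H₁^{⊗i₁} ⊗ ⋯ ⊗ H_r^{⊗i_r}`)] -/
theorem card_filter_eq_of_repr_wordProd_ne_zero :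
    ∀ (q : ℕ) (w : Fin q → Fin m) (s : Set.powersetCard (Fin N) (2 * q)), (bb (2 * q)).repr (Y q w) s ≠ 0 →
      ∀ k, ((s : Finset (Fin N)).filter fun j => (E.symm j).1 = k).card =
        2 * (Finset.univ.filter fun i => w i = k).card
  | 0, w, s, _, k => by
    have hs : (s : Finset (Fin N)) = ∅ := Finset.card_eq_zero.1 (Set.powersetCard.card_eq s)
    rw [hs, Finset.filter_empty, Finset.card_empty]
    simp
  | q + 1, w, s, hs, k => by
    classical
    rw [hYs] at hs
    obtain ⟨T, U, hT, hU, hsTU⟩ := exists_of_repr_cupProduct_ne_zero b₁ E bb hbb _ _ _ s hs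
    have ih := card_filter_eq_of_repr_wordProd_ne_zero q (Fin.init w) T hT k
    have hUk := hω _ U hU
    -- `T` and `U` are disjoint
    have hdisj : Disjoint (T : Finset (Fin N)) (U : Finset (Fin N)) := by
      rw [Finset.disjoint_iff_inter_eq_empty, ← Finset.card_eq_zero]
      have e := Finset.card_union_add_card_inter (T : Finset (Fin N)) (U : Finset (Fin N))
      rw [← hsTU, Set.powersetCard.card_eq s, Set.powersetCard.card_eq T, Set.powersetCard.card_eq U] at e
      omega
    -- block counts add
    rw [hsTU, Finset.filter_union, Finset.card_union_of_disjoint (Finset.disjoint_filter_filter hdisj), ih,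
      card_filter_succ]
    -- the block count of `U`
    have hUcount : ((U : Finset (Fin N)).filter fun j => (E.symm j).1 = k).card =
        if w (Fin.last q) = k then 2 else 0 := by
      by_cases hk : w (Fin.last q) = k
      · rw [if_pos hk, Finset.filter_true_of_mem (fun j hj => (hUk j hj).trans hk), Set.powersetCard.card_eq U]
      · rw [if_neg hk, Finset.card_eq_zero, Finset.filter_eq_empty_iff]
        exact fun j hj hjk => hk ((hUk j hj).symm.trans hjk)
    rw [hUcount]
    change _ = 2 * ((Finset.univ.filter fun i : Fin q => Fin.init w i = k).card + _)
    split_ifs <;> ring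

omit hY0 in
/-- **An over-full word gives zero**: if some letter `k` occurs more than `n_k` times, `ω_w = 0` (no
`2q`-set meets block `k` in more than its `2 n_k` indices). [cite: Milne1999LefschetzClasses, §3 proof of Prop. 3.6] -/
theorem wordProd_eq_zero_of_lt {q : ℕ} (w : Fin q → Fin m) {k : Fin m}
    (hk : n k < (Finset.univ.filter fun i => w i = k).card) : Y q w = 0 := by
  classical
  refine (bb (2 * q)).repr.injective (Finsupp.ext fun s => ?_)
  rw [map_zero, Finsupp.zero_apply]
  by_contra hs
  have h1 := card_filter_eq_of_repr_wordProd_ne_zero b₁ E bb hbb ω Y hYs hω q w s hs k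
  have h2 : ((s : Finset (Fin N)).filter fun j => (E.symm j).1 = k).card ≤ 2 * n k := by
    rw [← card_filter_fst_eq E k]
    exact Finset.card_le_card (Finset.filter_subset_filter _ (Finset.subset_univ _))
  omega

/-- **Full words do not vanish**: if `(Σ_k ω_k)^{Σ n_k} ≠ 0` then the product along every word using each
letter `k` exactly `n_k` times is non-zero (the power is the sum of the products along all words; the
over-full ones vanish and the full ones all agree). [cite: Milne1999LefschetzClasses, §3 Prop. 3.6 (a)]
[cite: VoisinHodgeI2002, §3.1.3 Cor. 3.9] -/
theorem wordProd_ne_zero_of_full {q : ℕ} (hq : ∑ k, n k = q) (hne : cupPowTwo (∑ k, ω k) q ≠ 0)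
    (w : Fin q → Fin m) (hw : ∀ k, (Finset.univ.filter fun i => w i = k).card = n k) : Y q w ≠ 0 := by
  classical
  intro hzero
  apply hne
  rw [cupPowTwo_sum_eq_sum_wordProd ω Y hY0 hYs q]
  refine Finset.sum_eq_zero fun w' _ => ?_
  by_cases hfull : ∀ k, (Finset.univ.filter fun i => w' i = k).card = n k
  · -- a full word is a permutation of `w`
    obtain ⟨σ, hσ⟩ := exists_perm_of_card_filter_eq w w' (fun k => by rw [hw, hfull])
    have : w' = fun i => w (σ i) := funext hσ
    rw [this, wordProd_comp_perm ω Y hY0 hYs q w σ, hzero]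
  · -- a non-full word is over-full in some letter
    push Not at hfull
    obtain ⟨k₀, hk₀⟩ := hfull
    have hsum := sum_card_filter_eq w'
    -- some letter count exceeds `n`
    have hlt : ∃ k, n k < (Finset.univ.filter fun i => w' i = k).card := by
      by_contra hall
      push Not at hall
      have hlt₀ : (Finset.univ.filter fun i => w' i = k₀).card < n k₀ := lt_of_le_of_ne (hall k₀) hk₀
      have : ∑ k, (Finset.univ.filter fun i => w' i = k).card < ∑ k, n k :=
        Finset.sum_lt_sum (fun k _ => hall k) ⟨k₀, Finset.mem_univ _, hlt₀⟩
      omega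
    obtain ⟨k, hk⟩ := hlt
    exact wordProd_eq_zero_of_lt b₁ E bb hbb ω Y hYs hω w' hk

/-- **Admissible words do not vanish**: if `(Σ_k ω_k)^{Σ n_k} ≠ 0` and the word `w` uses each letter `k` at
most `n_k` times, then `ω_w ≠ 0` (complete `w` to a full word `w ∗ v`; `ω_{w ∗ v} ≠ 0` forces `ω_w ≠ 0`).
[cite: Milne1999LefschetzClasses, §3 Prop. 3.6 (a)] [cite: VoisinHodgeI2002, §3.1.3 Cor. 3.9] -/
theorem wordProd_ne_zero_of_le (hne : cupPowTwo (∑ k, ω k) (∑ k, n k) ≠ 0) {p : ℕ}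
    (w : Fin p → Fin m) (hw : ∀ k, (Finset.univ.filter fun i => w i = k).card ≤ n k) : Y p w ≠ 0 := by
  classical
  -- the complementary word
  set c : Fin m → ℕ := fun k => n k - (Finset.univ.filter fun i => w i = k).card with hc
  set v : Fin (∑ k, c k) → Fin m := fun i => (finSigmaFinEquiv.symm i).1 with hv
  have hv_count : ∀ k, (Finset.univ.filter fun i => v i = k).card = c k := fun k => card_filter_sigmaWord c k
  have hfull : ∀ k, (Finset.univ.filter fun i => Fin.append w v i = k).card = n k := fun k => by
    rw [card_filter_append, hv_count, hc]
    exact Nat.add_sub_cancel' (hw k)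
  have hsum : ∑ k, n k = p + ∑ k, c k := by
    rw [← sum_card_filter_eq (Fin.append w v)]
    exact Finset.sum_congr rfl fun k _ => (hfull k).symm
  have hne' : cupPowTwo (∑ k, ω k) (p + ∑ k, c k) ≠ 0 := by rw [← hsum]; exact hne
  intro hzero
  exact wordProd_ne_zero_of_full b₁ E bb hbb ω Y hY0 hYs hω hsum hne' (Fin.append w v) hfull
    (wordProd_append_eq_zero ω Y hYs hzero _ v)

end WordSupport

/-! ### §7 Milne's Theorem 3.2 / Corollary 4.5 for several symplectic blocks (real multiplication) -/

section Main

variable {A : AbelianVariety ℂ}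

/-- Transport of letter counts along `Fin.cast`. [folklore] -/
private theorem card_filter_comp_cast {m a c : ℕ} (h : a = c) (v : Fin a → Fin m) (k : Fin m) :
    (Finset.univ.filter fun i : Fin c => v (Fin.cast h.symm i) = k).card =
      (Finset.univ.filter fun i => v i = k).card := by
  subst h
  rfl

/-- **`Σ_k n_k = dim A`** for a block basis `(e^k_i, f^k_i)_{k, i < n_k}` of `H¹(A(ℂ); ℂ)`
(`dim H¹ = 2 dim A`). [cite: LangeBirkenhake1992, §1.2 and Lemma 1.1.17] -/
theorem sum_eq_dim_of_blockBasis {m : ℕ} {n : Fin m → ℕ}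
    (b₁ : Module.Basis (Σ k : Fin m, Fin (n k) ⊕ Fin (n k)) ℂ (complexBetti A.X 1)) : ∑ k, n k = A.dim := by
  classical
  haveI : Module.Finite ℂ (complexBetti A.X 1) := abelianVarietyCohomologyExteriorH1_holds.finite_one A
  have h1 := Module.finrank_eq_card_basis b₁
  rw [AbelianVariety.finrank_complexBetti_one, Fintype.card_sigma] at h1
  simp only [Fintype.card_sum, Fintype.card_fin] at h1
  have h2 : ∑ k, (n k + n k) = 2 * ∑ k, n k := by rw [Finset.sum_add_distrib, two_mul]
  omega

/-- **Milne 1999, Prop. 3.6 (a) in every block, glued as on p. 656: the `S(A)(ℂ)`-invariants of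
`H^{2p}(A(ℂ); ℂ)` are Lefschetz classes, for real multiplication.** Let `φ ∈ End(A)` with `φ^*`
diagonalisable on `H¹(A(ℂ); ℂ)`, `C(A) ⊗ ℂ` the commutant of `φ^*`, and `h` a polarization class
(rational, with a Kähler multiple `s · h`, `s > 0`) for which `φ^*` is `Q_h`-symmetric (`φ† = φ`). Then every
invariant `x ∈ H^{2p}(A(ℂ); ℂ)` — fixed by `⋀^{2p}u` for all `u ∈ S(A)(ℂ) = unitaryCentralizerGroup A h` — lies in
`Dᵖ(A) ⊗ ℂ = divisorClassesSpan A.X (dim A) p`. Proof: block-symplectic eigenbasis of `(H¹, λ ∘ Q_h, φ^*)`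
(§1); its torus and block permutations lie in `S(A)(ℂ)` (§2); block components `ω_k = ⋀²e_k h ∈ B¹ ⊗ ℂ`
with `h = Σ_k ω_k` (§5); the products `ω_w ∈ Dᵖ ⊗ ℂ` along words with `p_k ≤ n_k` letters `k` are
invariant, supported on their profile and non-zero (§6, `h^{dim A} ≠ 0`); the engine (§4) concludes.
Degree `0` (`H⁰ = ℂ · 1`) and `dim A = 0` (`H^{2p} = 0`) apart.
[cite: Milne1999LefschetzClasses, §2 p. 648 (type I), Thm. 3.2, Props. 3.3–3.4, 3.6 (a), p. 656]
[cite: FultonHarris1991, §16.1 and Thm. 17.5] [cite: VoisinHodgeI2002, §3.1.3 Cor. 3.9 and §7.1.2] -/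
theorem mem_divisorClassesSpan_of_forall_exteriorPullback_eq_of_selfAdjoint (φ : A ⟶ A)
    (hC : centralizerAlgebra A = Subalgebra.centralizer ℂ {pullbackOne A φ})
    (hdiag : ⨆ μ : ℂ, Module.End.eigenspace (pullbackOne A φ) μ = ⊤)
    {h : complexBetti A.X 2} (hQ : IsRationalClass h)
    (hK : ∃ s : ℝ, 0 < s ∧ IsKaehlerClass A.dim A.X ((s : ℂ) • h))
    (hJQ : ∀ x y : complexBetti A.X 1,
      polarizationPairingOne A.X h (A.dim - 1) (pullbackOne A φ x) y =
        polarizationPairingOne A.X h (A.dim - 1) x (pullbackOne A φ y))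
    (p : ℕ) (x : complexBetti A.X (2 * p))
    (hx : ∀ u ∈ unitaryCentralizerGroup A h,
      exteriorPullback (AbelianVariety.hasExteriorCohomologyH1_complexPoints A)
        (u : complexBetti A.X 1 →ₗ[ℂ] complexBetti A.X 1) (2 * p) x = x) :
    x ∈ divisorClassesSpan A.X A.dim p := by
  classical
  haveI : Module.Finite ℂ (complexBetti A.X 1) := abelianVarietyCohomologyExteriorH1_holds.finite_one A
  have hX := AbelianVariety.hasExteriorCohomologyH1_complexPoints A
  -- degree `0`: everything is a multiple of the unit class
  rcases Nat.eq_zero_or_pos p with rfl | hp1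
  · have htop : Submodule.span ℂ (Set.range (cupPowOne ℂ (ComplexPoints A.X) 0)) = ⊤ :=
      hX.span_range_cupPowOne 0
    have hrange : Set.range (cupPowOne ℂ (ComplexPoints A.X) 0) =
        {singularCohomology.one ℂ (ComplexPoints A.X)} := by
      ext c
      simp only [Set.mem_range, cupPowOne_zero, Set.mem_singleton_iff]
      exact ⟨fun ⟨_, e⟩ => e.symm, fun e => ⟨fun i => Fin.elim0 i, e.symm⟩⟩
    have hx' : x ∈ Submodule.span ℂ (Set.range (cupPowOne ℂ (ComplexPoints A.X) 0)) := by
      rw [htop]; exact Submodule.mem_top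
    rw [hrange] at hx'
    refine Submodule.span_mono (fun c hc => ?_) hx'
    rw [Set.mem_singleton_iff] at hc
    exact mem_divisorMonomials_zero.2 hc
  -- dimension `0`: no classes in positive degree
  rcases Nat.eq_zero_or_pos A.dim with hA | hA0
  · haveI : Subsingleton (complexBetti A.X (2 * p)) :=
      hX.subsingleton_of_lt (by rw [AbelianVariety.finrank_complexBetti_one]; omega)
    rw [Subsingleton.elim x 0]
    exact Submodule.zero_mem _
  obtain ⟨s, hs, hKs⟩ := hK
  have hnd := eq_zero_of_forall_polarizationPairingOne_eq_zero_of_isKaehlerClass_smul' hs.ne' hKs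
  have hh : h ∈ hodgeClassSpan A.dim A.X 1 := mem_hodgeClassSpan_one_of_isKaehlerClass_smul hQ hs.ne' hKs
  have hh11 : IsOfHodgeType A.dim A.X 2 1 1 h := by
    have e := (hKs.isOfHodgeType_one_one).smul ((s : ℂ)⁻¹)
    rwa [smul_smul, inv_mul_cancel₀ (Complex.ofReal_ne_zero.2 hs.ne'), one_smul] at e
  have hdiv : h ∈ divisorClassesSpan A.X A.dim 1 := mem_divisorClassesSpan_one hQ hh11
  -- the scalar form `B = λ ∘ Q_h`; `J = φ^*` is `B`-self-adjoint
  obtain ⟨B, hBalt, hBnd, lam, hlam, hBapp⟩ := exists_bilinForm_isAlt_nondegenerate (A := A) hnd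
  set J : Module.End ℂ (complexBetti A.X 1) := pullbackOne A φ with hJ_def
  have hJB : ∀ x y, B (J x) y = B x (J y) := fun x y => by rw [hBapp, hBapp, hJ_def, hJQ]
  -- the block-symplectic eigenbasis
  obtain ⟨m, n, μ, b₁, hμ, hJb, hcross, h11, h22, h12⟩ := exists_blockSymplecticBasis B hBalt hBnd J hdiag hJB
  have h21 : ∀ k (i j : Fin (n k)), B (b₁ ⟨k, Sum.inr i⟩) (b₁ ⟨k, Sum.inl j⟩) = if i = j then -1 else 0 := by
    intro k i j
    rw [← hBalt.neg_eq, h12]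
    by_cases hij : i = j
    · subst hij; simp
    · rw [if_neg (Ne.symm hij), if_neg hij, neg_zero]
  -- membership in `S(A)(ℂ)`: commute with `J` (hence with `End(A)`, by `hC`) and preserve `B`
  have hmem : ∀ u : complexBetti A.X 1 ≃ₗ[ℂ] complexBetti A.X 1,
      J * (u : Module.End ℂ (complexBetti A.X 1)) = (u : Module.End ℂ (complexBetti A.X 1)) * J →
      (∀ a c, B (u a) (u c) = B a c) → u ∈ unitaryCentralizerGroup A h := by
    intro u hcomm hu
    refine ⟨mem_centralizerGroup_iff_coe_mem.2 ?_, fun a c => hlam (by rw [← hBapp, ← hBapp, hu a c])⟩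
    rw [hC, Subalgebra.mem_centralizer_iff]
    intro g hg
    rw [Set.mem_singleton_iff] at hg
    rw [hg]
    exact hcomm
  -- reindexing of the basis and the cup-monomial bases of all degrees
  obtain ⟨N, ⟨E⟩⟩ : ∃ N : ℕ, Nonempty ((Σ k : Fin m, Fin (n k) ⊕ Fin (n k)) ≃ Fin N) :=
    ⟨_, ⟨Fintype.equivFin _⟩⟩
  have hbb' := fun d => exists_monomialBasis (b₁.reindex E) d
  choose bb hbb using hbb'
  -- the torus and the block permutations lie in `S(A)(ℂ)`
  have htorus : ∀ (k : Fin m) (i : Fin (n k)), ∃ u ∈ unitaryCentralizerGroup A h,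
      ∃ dg : (Σ k : Fin m, Fin (n k) ⊕ Fin (n k)) → ℂ, (∀ a, u (b₁ a) = dg a • b₁ a) ∧
        ∀ s : Finset (Σ k : Fin m, Fin (n k) ⊕ Fin (n k)), ∏ a ∈ s, dg a = 1 →
          ((⟨k, Sum.inl i⟩ : Σ k : Fin m, Fin (n k) ⊕ Fin (n k)) ∈ s ↔ ⟨k, Sum.inr i⟩ ∈ s) := by
    intro k i
    obtain ⟨u, huB, dg, hdg, hiff⟩ := exists_blockTorusElement B b₁ h11 h22 h12 h21 hcross k i
    exact ⟨u, hmem u (mul_eq_mul_of_blockDiag b₁ J hJb u hdg) huB, dg, hdg, hiff⟩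
  have hperm : ∀ σ : ∀ k : Fin m, Equiv.Perm (Fin (n k)), ∃ u ∈ unitaryCentralizerGroup A h,
      ∀ a, u (b₁ a) = b₁ ((Equiv.sigmaCongrRight fun k => (σ k).sumCongr (σ k)) a) := by
    intro σ
    obtain ⟨u, huB, hu⟩ := exists_blockPermElement B b₁ h11 h22 h12 h21 hcross σ
    exact ⟨u, hmem u (mul_eq_mul_of_blockPerm b₁ J hJb u σ hu) huB, hu⟩
  -- the block projectors `e_k = ℓ_k(φ^*)` and the block components `ω_k = ⋀²e_k h ∈ B¹ ⊗ ℂ`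
  have hproj := fun k => exists_blockProjector b₁ φ hμ hJb k
  choose P hP hPmem using hproj
  set ω : Fin m → complexBetti A.X 2 := fun k => exteriorPullback hX (P k) 2 h with hω_def
  have hωmem : ∀ k, ω k ∈ hodgeClassSpan A.dim A.X 1 := fun k => hPmem k h hh
  have hωrepr : ∀ (k : Fin m) (t : Set.powersetCard (Fin N) 2),
      (bb 2).repr (ω k) t = (∏ j ∈ (t : Finset (Fin N)), (if (E.symm j).1 = k then (1 : ℂ) else 0)) * (bb 2).repr h t :=
    fun k t => repr_exteriorPullback_of_diag b₁ E (bb 2) (hbb 2) (P k) (hP k) h t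
  have hωsupp : ∀ (k : Fin m) (t : Set.powersetCard (Fin N) 2),
      (bb 2).repr (ω k) t ≠ 0 → ∀ j ∈ (t : Finset (Fin N)), (E.symm j).1 = k := by
    intro k t ht j hj
    by_contra hjk
    apply ht
    rw [hωrepr, Finset.prod_eq_zero hj (if_neg hjk), zero_mul]
  -- `h` is `S(A)(ℂ)`-invariant, hence supported on the pairs `{e^k_i, f^k_i}`; so `h = Σ_k ω_k`
  have hinvh : ∀ u ∈ unitaryCentralizerGroup A h,
      exteriorPullback hX (u : complexBetti A.X 1 →ₗ[ℂ] complexBetti A.X 1) 2 h = h := fun u hu =>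
    exteriorPullback_eq_self_of_mem_divisorClassesSpan_of_nondegenerate hh hnd hu 1 hdiv
  have hsumω : ∑ k, ω k = h := by
    refine (bb 2).repr.injective (Finsupp.ext fun t => ?_)
    rw [map_sum, Finsupp.finsetSum_apply]
    simp_rw [hωrepr]
    rw [← Finset.sum_mul]
    by_cases ht : (bb 2).repr h t = 0
    · rw [ht, mul_zero]
    · have hbal := balanced_of_repr_ne_zero b₁ E (bb 2) (hbb 2) (unitaryCentralizerGroup A h) htorus hinvh ht
      obtain ⟨k₀, hk₀⟩ := exists_forall_fst_eq_of_balanced_two E t hbal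
      have hne : (t : Finset (Fin N)).Nonempty := by
        rw [← Finset.card_pos, Set.powersetCard.card_eq t]
        norm_num
      obtain ⟨j₀, hj₀⟩ := hne
      rw [Finset.sum_eq_single k₀, Finset.prod_eq_one (fun j hj => if_pos (hk₀ j hj)), one_mul]
      · intro k _ hk
        exact Finset.prod_eq_zero hj₀ (if_neg fun e => hk (e.symm.trans (hk₀ j₀ hj₀)))
      · intro hk₀'
        exact absurd (Finset.mem_univ k₀) hk₀'
  -- the products `ω_w` along words (by recursion; no definition)
  let Y : ∀ q : ℕ, (Fin q → Fin m) → complexBetti A.X (2 * q) := fun q =>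
    Nat.rec (motive := fun q => (Fin q → Fin m) → complexBetti A.X (2 * q))
      (fun _ => singularCohomology.one ℂ (ComplexPoints A.X))
      (fun q ih w => cupProduct (two_mul_add_two q) (ih (Fin.init w)) (ω (w (Fin.last q)))) q
  have hY0 : ∀ w, Y 0 w = singularCohomology.one ℂ (ComplexPoints A.X) := fun _ => rfl
  have hYs : ∀ (q : ℕ) (w : Fin (q + 1) → Fin m),
      Y (q + 1) w = cupProduct (two_mul_add_two q) (Y q (Fin.init w)) (ω (w (Fin.last q))) := fun _ _ => rfl
  -- `Σ_k n_k = dim A` and `h^{dim A} ≠ 0`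
  have hdimsum : ∑ k, n k = A.dim := sum_eq_dim_of_blockBasis b₁
  have hne : cupPowTwo (∑ k, ω k) (∑ k, n k) ≠ 0 := by
    rw [hsumω, hdimsum]
    intro h0
    have e := hKs.cupPowTwo_ne_zero (AbelianVariety.isSmoothProjective_holds (A := A)) hA0 le_rfl
    rw [cupPowTwo_smul, h0, smul_zero] at e
    exact e rfl
  -- the engine
  refine mem_of_forall_exteriorPullback_eq_of_blockBasis b₁ E (bb (2 * p)) (hbb (2 * p))
    (unitaryCentralizerGroup A h) htorus hperm (divisorClassesSpan A.X A.dim p) (fun s₀ hs₀ => ?_) hx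
  -- the block profile `(c_k)` of the balanced set `s₀`: `2 c_k` indices in block `k`, `Σ c_k = p`, `c_k ≤ n_k`
  obtain ⟨c, hc_def⟩ : ∃ c : Fin m → ℕ,
      ∀ k, c k = (Finset.univ.filter fun i : Fin (n k) => E ⟨k, Sum.inl i⟩ ∈ (s₀ : Finset (Fin N))).card :=
    ⟨_, fun k => rfl⟩
  have hc2 : ∀ k, 2 * c k = ((s₀ : Finset (Fin N)).filter fun j => (E.symm j).1 = k).card := fun k => by
    rw [hc_def]
    exact two_mul_card_filter_eq_blockCount E k s₀ hs₀
  have hcle : ∀ k, c k ≤ n k := fun k => by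
    rw [hc_def]
    refine (Finset.card_filter_le _ _).trans ?_
    rw [Finset.card_univ, Fintype.card_fin]
  have hcsum : ∑ k, c k = p := by
    have e := Finset.card_eq_sum_card_fiberwise (f := fun j => (E.symm j).1) (s := (s₀ : Finset (Fin N)))
      (t := Finset.univ) (fun j _ => Finset.mem_univ _)
    rw [Set.powersetCard.card_eq s₀] at e
    have e2 : ∑ k, ((s₀ : Finset (Fin N)).filter fun j => (E.symm j).1 = k).card = 2 * ∑ k, c k := by
      rw [Finset.mul_sum]
      exact Finset.sum_congr rfl fun k _ => (hc2 k).symm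
    omega
  -- a word with `c_k` letters `k`, and its product
  obtain ⟨w, hwcount⟩ : ∃ w : Fin p → Fin m, ∀ k, (Finset.univ.filter fun i => w i = k).card = c k := by
    refine ⟨fun i => (finSigmaFinEquiv.symm (Fin.cast hcsum.symm i)).1, fun k => ?_⟩
    rw [card_filter_comp_cast hcsum (fun i : Fin (∑ k, c k) => (finSigmaFinEquiv.symm i).1) k,
      card_filter_sigmaWord]
  have hymem : Y p w ∈ divisorClassesSpan A.X A.dim p := wordProd_mem_divisorClassesSpan ω Y hY0 hYs hωmem p w
  refine ⟨Y p w, hymem, fun u hu => ?_, ?_, fun t ht k => ?_⟩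
  · exact exteriorPullback_eq_self_of_mem_divisorClassesSpan_of_nondegenerate hh hnd hu p hymem
  · exact wordProd_ne_zero_of_le b₁ E bb hbb ω Y hY0 hYs hωsupp hne w (fun k => (hwcount k).le.trans (hcle k))
  · rw [card_filter_eq_of_repr_wordProd_ne_zero b₁ E bb hbb ω Y hYs hωsupp p w t ht k, hwcount, hc2]

/-- **The conclusion of the record `Milne1999_specialLefschetzGroup_invariants_le` (Milne 1999, Cor. 4.5
with Thm. 4.4 and Thm. 3.2 / Prop. 3.6 (a), several symplectic blocks) PROVED for real multiplication**:
for a complex abelian variety `A` with `φ ∈ End(A)`, `φ^*` diagonalisable on `H¹(A(ℂ); ℂ)`, `C(A) ⊗ ℂ`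
the commutant of `φ^*`, and a polarization class `h` (rational, with a Kähler multiple) for which `φ^*` is
`Q_h`-symmetric (Milne §2, "simple abelian variety of type I": `S(A)(ℂ) = ∏_σ Sp(H_σ)`), every class
`x ∈ H^{2p}(A(ℂ); ℂ)` fixed by every element of `specialLefschetzGroup (dim A) A.X` lies in
`Dᵖ_hom(A)_ℂ = divisorClassesSpan A.X (dim A) p`: `⋀•u ∈ specialLefschetzGroup` for `u ∈ S(A)(ℂ)`
(`exteriorPullbackEquiv_mem_specialLefschetzGroup`, Thm. 4.4), so `x` is `S(A)(ℂ)`-invariant and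
`mem_divisorClassesSpan_of_forall_exteriorPullback_eq_of_selfAdjoint` applies (in dimension `0` there is
nothing to prove). [cite: Milne1999LefschetzClasses, §2 p. 648, Cor. 4.5 and p. 659, Thm. 3.2, Prop. 3.6 (a), p. 656]
[cite: VoisinHodgeI2002, §3.1.3 Cor. 3.9 and §7.1.2] -/
theorem specialLefschetzGroup_invariants_le_of_selfAdjoint (φ : A ⟶ A)
    (hC : centralizerAlgebra A = Subalgebra.centralizer ℂ {pullbackOne A φ})
    (hdiag : ⨆ μ : ℂ, Module.End.eigenspace (pullbackOne A φ) μ = ⊤)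
    {h : complexBetti A.X 2} (hQ : IsRationalClass h)
    (hK : ∃ s : ℝ, 0 < s ∧ IsKaehlerClass A.dim A.X ((s : ℂ) • h))
    (hJQ : ∀ x y : complexBetti A.X 1,
      polarizationPairingOne A.X h (A.dim - 1) (pullbackOne A φ x) y =
        polarizationPairingOne A.X h (A.dim - 1) x (pullbackOne A φ y))
    (p : ℕ) (x : complexBetti A.X (2 * p)) (hx : ∀ g ∈ specialLefschetzGroup A.dim A.X, g (2 * p) x = x) :
    x ∈ divisorClassesSpan A.X A.dim p := by
  classical
  haveI : Module.Finite ℂ (complexBetti A.X 1) := abelianVarietyCohomologyExteriorH1_holds.finite_one A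
  have hX := AbelianVariety.hasExteriorCohomologyH1_complexPoints A
  -- dimension `0`: `H¹ = 0`, so `H^{2p} = 0` for `p ≥ 1` and `H⁰ = ℂ · 1`
  rcases Nat.eq_zero_or_pos A.dim with hA | hA0
  · rcases Nat.eq_zero_or_pos p with rfl | hp1
    · have htop : Submodule.span ℂ (Set.range (cupPowOne ℂ (ComplexPoints A.X) 0)) = ⊤ :=
        hX.span_range_cupPowOne 0
      have hrange : Set.range (cupPowOne ℂ (ComplexPoints A.X) 0) =
          {singularCohomology.one ℂ (ComplexPoints A.X)} := by
        ext c
        simp only [Set.mem_range, cupPowOne_zero, Set.mem_singleton_iff]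
        exact ⟨fun ⟨_, e⟩ => e.symm, fun e => ⟨fun i => Fin.elim0 i, e.symm⟩⟩
      have hx' : x ∈ Submodule.span ℂ (Set.range (cupPowOne ℂ (ComplexPoints A.X) 0)) := by
        rw [htop]; exact Submodule.mem_top
      rw [hrange] at hx'
      refine Submodule.span_mono (fun c hc => ?_) hx'
      rw [Set.mem_singleton_iff] at hc
      exact mem_divisorMonomials_zero.2 hc
    · haveI : Subsingleton (complexBetti A.X (2 * p)) :=
        hX.subsingleton_of_lt (by rw [AbelianVariety.finrank_complexBetti_one]; omega)
      rw [Subsingleton.elim x 0]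
      exact Submodule.zero_mem _
  -- positive dimension: `x` is `S(A)(ℂ)`-invariant by Thm. 4.4
  obtain ⟨s, hs, hKs⟩ := hK
  have hnd := eq_zero_of_forall_polarizationPairingOne_eq_zero_of_isKaehlerClass_smul' hs.ne' hKs
  have hh : h ∈ hodgeClassSpan A.dim A.X 1 := mem_hodgeClassSpan_one_of_isKaehlerClass_smul hQ hs.ne' hKs
  have htopne : lefschetzPow h (A.dim - 1) 2 h ≠ 0 := lefschetzPow_self_ne_zero_of_isKaehlerClass_smul hA0 hKs
  have hx' : ∀ u ∈ unitaryCentralizerGroup A h, exteriorPullback hX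
      (u : complexBetti A.X 1 →ₗ[ℂ] complexBetti A.X 1) (2 * p) x = x := fun u hu =>
    hx _ (exteriorPullbackEquiv_mem_specialLefschetzGroup hA0 hh htopne hnd hu)
  exact mem_divisorClassesSpan_of_forall_exteriorPullback_eq_of_selfAdjoint φ hC hdiag hQ ⟨s, hs, hKs⟩ hJQ p x hx'

/-- **Cor. 4.5 as an equality of sets, for real multiplication**: the `S(A)`-invariants of
`H^{2p}(A(ℂ); ℂ)` are EXACTLY `Dᵖ_hom(A)_ℂ` (the converse inclusion is definitional,
`apply_eq_self_of_mem_specialLefschetzGroup`). [cite: Milne1999LefschetzClasses, Cor. 4.5 (p. 659)] -/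
theorem setOf_forall_apply_eq_self_eq_divisorClassesSpan_of_selfAdjoint (φ : A ⟶ A)
    (hC : centralizerAlgebra A = Subalgebra.centralizer ℂ {pullbackOne A φ})
    (hdiag : ⨆ μ : ℂ, Module.End.eigenspace (pullbackOne A φ) μ = ⊤)
    {h : complexBetti A.X 2} (hQ : IsRationalClass h)
    (hK : ∃ s : ℝ, 0 < s ∧ IsKaehlerClass A.dim A.X ((s : ℂ) • h))
    (hJQ : ∀ x y : complexBetti A.X 1,
      polarizationPairingOne A.X h (A.dim - 1) (pullbackOne A φ x) y =
        polarizationPairingOne A.X h (A.dim - 1) x (pullbackOne A φ y)) (p : ℕ) :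
    {x : complexBetti A.X (2 * p) | ∀ g ∈ specialLefschetzGroup A.dim A.X, g (2 * p) x = x} =
      (divisorClassesSpan A.X A.dim p : Set _) :=
  Set.Subset.antisymm
    (fun x hx => specialLefschetzGroup_invariants_le_of_selfAdjoint φ hC hdiag hQ hK hJQ p x hx)
    fun _ hx _ hg => apply_eq_self_of_mem_specialLefschetzGroup hg hx

/-- **Milne Prop. 4.8, (c) ⇒ (a) on `A` itself, unconditionally for real multiplication**: if
`Hg′(A) = S(A)` then every rational `(p,p)`-class of `A` is fixed by `S(A)`, hence lies in `Dᵖ ⊗ ℂ` —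
`IsDivisorGenerated A`. [cite: Milne1999LefschetzClasses, Prop. 4.8 and Cor. 4.5 (pp. 659–660)] -/
theorem isDivisorGenerated_of_hodgeGroup_eq_specialLefschetzGroup_of_selfAdjoint (φ : A ⟶ A)
    (hC : centralizerAlgebra A = Subalgebra.centralizer ℂ {pullbackOne A φ})
    (hdiag : ⨆ μ : ℂ, Module.End.eigenspace (pullbackOne A φ) μ = ⊤)
    {h : complexBetti A.X 2} (hQ : IsRationalClass h)
    (hK : ∃ s : ℝ, 0 < s ∧ IsKaehlerClass A.dim A.X ((s : ℂ) • h))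
    (hJQ : ∀ x y : complexBetti A.X 1,
      polarizationPairingOne A.X h (A.dim - 1) (pullbackOne A φ x) y =
        polarizationPairingOne A.X h (A.dim - 1) x (pullbackOne A φ y))
    (hHg : hodgeGroup A.dim A.X = specialLefschetzGroup A.dim A.X) : IsDivisorGenerated A :=
  fun p c hc hpp => specialLefschetzGroup_invariants_le_of_selfAdjoint φ hC hdiag hQ hK hJQ p c
    fun _ hg => apply_eq_self_of_mem_hodgeGroup (hHg ▸ hg) hc hpp

end Main

end Literature.AlgebraicGeometry.Milne1999

end
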